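import Literature.Analysis.FluidPDE.TaoFourierSchur
import Literature.Analysis.FluidPDE.CoordDerivatives
import Literature.Analysis.FluidPDE.SolenoidalL2Duality
import Literature.Analysis.UnboundedOperators.HeatKernelFourier
import Literature.Analysis.UnboundedOperators.HeatFlowCalculus
import Literature.Analysis.FunctionSpaces.TimeMollification
import Mathlib.Analysis.Fourier.Inversion

/-!
# The Leray-projected heat kernel as a divergence-free `H¹` test field

Analysis/FluidPDE support file for the discharge of the named fact
`Literature.Analysis.FluidPDE.tao2011_duhamelNonlinearSpeed_unit` (`TaoBoundedTotalSpeed.lean`: the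
nonlinear part of Tao 2011, Prop. 9.1, *bounded total speed*, arXiv:1108.1165 §9). Tao's proof
starts from the Duhamel formula (9.2), `u(t) = e^{tΔ}u₀ + ∫₀ᵗ e^{(t-t')Δ} P∇·(u ⊗ u)(t') dt'`. In
the tree the Duhamel formula of a finite energy solution is available only in *tested* form,
against divergence-free fields (`IsLerayHopfOn.integral_inner_eq_mild_of_hasWeakGradient`,
`LerayHopfMildH1.lean`, tests in `H¹_σ`). To evaluate the solution *pointwise* one tests against
the Leray projection of a concentrating kernel; the most economical choice is the heat kernel
itself:

  `φ = P(G_σ(· - x₀) e)`,  `φ̂ⱼ(ξ) = 𝐞(⟪x₀, ξ⟫) e^{-4π²σ‖ξ‖²} (P̂(ξ) e)ⱼ`,  `P̂(ξ) = id - ξ ⊗ ξ/|ξ|²`,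

defined here through its Fourier integral (`lerayHeatTest x₀ σ e`, componentwise
`re 𝓕[symbol]`). Everything in this file is **proved**:

* `lerayHeatTest x₀ σ e` is smooth, bounded, in `L²` with square-integrable gradient
  (Plancherel on `L¹ ∩ L²`, tree `PlancherelL1L2`), and **divergence free**
  (`isDivFree_lerayHeatTest`: on the Fourier side `Σⱼ ξⱼ (P̂(ξ)e)ⱼ = 0`), hence an admissible
  `H¹_σ` test field (`memLp_two_lerayHeatTest`, `isWeaklyDivFree_lerayHeatTest`,
  `hasWeakGradient_lerayHeatTest`, `lintegral_frobeniusNormSq_fderiv_lerayHeatTest_lt_top`);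
* **the heat flow shifts the parameter**: `e^{sΔ} P(G_σ(·-x₀) e) = P(G_{σ+s}(·-x₀) e)`
  (`heatExtension_lerayHeatTest`; the caloric extension of `re 𝓕 n` is `re 𝓕 (e^{-4π²s|ξ|²} n)`,
  `heatExtension_re_fourier`, by Fubini and `𝓕 G_s = e^{-4π²s|ξ|²}`);
* **the pairing identity** (`integral_inner_lerayHeatTest`): for every `w ∈ L²(ℝ³; ℝ³)` weakly
  divergence free, `∫ ⟪w, P(G_σ(·-x₀) e)⟫ = ⟪(e^{σΔ} w)(x₀), e⟫`. Indeed
  `P(G_σ(·-x₀) e) = G_σ(·-x₀) e - ∇Q` with a smooth potential `Q = re 𝓕[c]`,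
  `c(ξ) = 𝐞(⟪x₀,ξ⟫) e^{-4π²σ‖ξ‖²} ⟪ξ,e⟫ / (-2πi‖ξ‖²)` (integrable: `‖ξ‖⁻¹` is integrable near the
  origin of `ℝ³`), `∇Q ∈ L²`, and **`L²_σ ⊥ ∇Q`**
  (`IsWeaklyDivFree.integral_inner_gradient_eq_zero_of_memLp`: `w ∈ L²_σ` by the tree's
  `mem_solenoidalL2_iff_holds`, `C_{c,σ}^∞` is dense in `L²_σ`, and a compactly supported
  divergence-free field is orthogonal to `∇Q` for *any* smooth `Q` — replace `Q` by `χQ` with a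
  cut-off `χ = 1` near its support);
* **the pairing bound** (`enorm_integral_mul_fderiv_lerayHeatTest_le`): for real `F ∈ L¹(ℝ³)`,
  `|∫ F (D P(G_σ e)(x) v)ⱼ dx| ≤ 2π‖v‖‖e‖ ∫ ‖ξ‖ e^{-4π²σ‖ξ‖²} |𝓕F(ξ)| dξ` (self-adjointness of `𝓕`,
  `∫ F 𝓕S = ∫ 𝓕F S`, and `|symbol of ∂ᵥφⱼ| ≤ 2π‖v‖‖e‖‖ξ‖e^{-4π²σ‖ξ‖²}`).

With `φ = P(G_ε(·-x₀) eₖ)` in the tested Duhamel formula one gets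
`(e^{εΔ}u(t))ₖ(x₀) - (e^{(t+ε)Δ}u₀)ₖ(x₀) = ∫₀ᵗ Σᵢⱼ ∫ uᵢuⱼ ∂ᵢφⱼ^{(t-τ)}`, each term bounded by the
pairing bound uniformly in `ε`; `ε → 0` then bounds `u(t) - e^{tΔ}u₀` pointwise by a
Fourier–Lebesgue integral of `𝓕(uᵢuⱼ)`, to which the bilinear estimate of `TaoFourierSchur.lean`
applies (next file).

## Main definitions

* `projCoeff e j ξ = eⱼ - ξⱼ⟪ξ,e⟫/‖ξ‖²` (`= (leraySymbol ξ e)ⱼ`, `projCoeff_eq_leraySymbol_apply`);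
  `transHeatSymbol x₀ σ ξ = 𝐞(⟪x₀,ξ⟫) e^{-4π²σ‖ξ‖²}` (`𝓕` of it is `G_σ(· - x₀)`,
  `fourier_transHeatSymbol`); `lerayHeatSymbol`, `lerayHeatDerivSymbol`, `lerayHeatPotSymbol`:
  the symbols of `φⱼ`, `∂ᵥφⱼ` and of the potential `Q`;
* `lerayHeatTest x₀ σ e : ℝ³ → ℝ³`, the test field; `lerayHeatPot x₀ σ e`, the potential `Q`.

## Mathlib / tree search

Mathlib (this pin): the Fourier integral on inner product spaces with `Real.fderiv_fourier`,
`Real.contDiff_fourier`, `Continuous.fourierInv_fourier_eq` (inversion),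
`VectorFourier.integral_fourierIntegral_smul_eq_flip` (self-adjointness), the `L²` theory
`Lp.fourierTransformₗᵢ`, and `gradient`; no Leray projector as an operator on functions, no
Gauss–Weierstrass semigroup on functions (`lean search 'Leray|solenoidal|heatKernel'` in Mathlib:
nothing). Tree: the Leray symbol `leraySymbol` and `L²_σ` (`LerayProjector`,
`SolenoidalL2Duality`: `mem_solenoidalL2_iff_holds`, `denseRange_divFreeTestToSolenoidalL2`), the
heat kernel and its transform (`UnboundedOperators/HeatKernel*`: `heatKernel`, `heatSymbol`,
`fourierIntegral_heatKernel_holds`, `heatExtension`), Plancherel on `L¹ ∩ L²`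
(`FunctionSpaces/PlancherelL1L2`), radial integrals on `ℝ³` (`TaoFourierSchur`:
`lintegral_ball_norm_inv`), coordinates on `ℝ³` (`CoordDerivatives`: `famVec`, `stdVec`,
`pderiv`, `divergence_eq_sum_pderiv`). No prior test field of this kind
(`lean search 'lerayHeat|projCoeff|transHeatSymbol' --decl`: nothing).

## References

* T. Tao, *Localisation and compactness properties of the Navier–Stokes global regularity
  problem*, Anal. PDE 6 (2013) 25–107 = arXiv:1108.1165, §9, proof of Prop. 9.1 ((9.1)–(9.2):
  the projected equation and the Duhamel formula). [`Tao2011`]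
* P. G. Lemarié-Rieusset, *The Navier–Stokes problem in the 21st century*, CRC Press (2016),
  §6.1–6.2 (the Leray projector `P = Id - ∇Δ⁻¹∇·` as the Fourier multiplier
  `δⱼₖ - ξⱼξₖ/|ξ|²`; the heat kernel and the Oseen tensor). [`LemarieRieusset2016`]
-/

noncomputable section

open MeasureTheory Set Function Filter Topology Metric Real Complex
open scoped ENNReal NNReal FourierTransform RealInnerProductSpace ContDiff

namespace Literature.Analysis.FluidPDE

open UnboundedOperators

/-- Local notation for `ℝ³ = EuclideanSpace ℝ (Fin 3)`. -/
local notation "ℝ³" => EuclideanSpace ℝ (Fin 3)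

/-! ## Generic facts: real parts of Fourier integrals of integrable symbols -/

section Symbols

variable {n S : ℝ³ → ℂ}

/-- The Fourier integral of an integrable symbol is continuous and bounded by `‖n‖_{L¹}`.
[folklore] -/
theorem continuous_fourier_of_integrable (hn : Integrable n) : Continuous (𝓕 n) :=
  Literature.Analysis.FunctionSpaces.continuous_fourierIntegral hn

/-- `‖𝓕 n x‖ ≤ ∫ ‖n‖`. [folklore] -/
theorem norm_fourier_le_integral_norm (n : ℝ³ → ℂ) (x : ℝ³) : ‖𝓕 n x‖ ≤ ∫ ξ, ‖n ξ‖ :=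
  VectorFourier.norm_fourierIntegral_le_integral_norm _ _ _ _ _

/-- **Self-adjointness of the Fourier transform** (multiplication formula) on `ℝ³`:
`∫ F · 𝓕 S = ∫ 𝓕 F · S` for integrable `F, S`. [folklore] -/
theorem integral_mul_fourier_eq {F S : ℝ³ → ℂ} (hF : Integrable F) (hS : Integrable S) :
    ∫ x, F x * 𝓕 S x = ∫ ξ, 𝓕 F ξ * S ξ := by
  have h : ∫ ξ, 𝓕 F ξ • S ξ = ∫ x, F x • 𝓕 S x := by
    have h0 := VectorFourier.integral_fourierIntegral_smul_eq_flip (L := innerₗ ℝ³) (μ := volume)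
      (ν := volume) Real.continuous_fourierChar continuous_inner hF hS
    rw [flip_innerₗ] at h0
    exact h0
  simp only [smul_eq_mul] at h
  exact h.symm

/-- An `L¹` function times the Fourier integral of an integrable symbol is integrable. [folklore] -/
theorem integrable_mul_fourier {F : ℝ³ → ℂ} (hF : Integrable F) (hS : Integrable S) :
    Integrable (fun x => F x * 𝓕 S x) :=
  hF.mul_bdd (continuous_fourier_of_integrable hS).aestronglyMeasurable
    (Eventually.of_forall fun x => norm_fourier_le_integral_norm S x)

/-- **The pairing bound**: for integrable real `F` and an integrable symbol `S` with
`‖S ξ‖ ≤ B ξ`, `‖∫ F(x) re (𝓕 S)(x) dx‖ ≤ ∫ ‖𝓕 F(ξ)‖ B(ξ) dξ` (multiplication formula).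
[folklore] -/
theorem enorm_integral_mul_re_fourier_le {F : ℝ³ → ℝ} {S : ℝ³ → ℂ} {B : ℝ³ → ℝ≥0∞}
    (hF : Integrable F) (hS : Integrable S) (hB : ∀ ξ, ‖S ξ‖ₑ ≤ B ξ) :
    ‖∫ x, F x * (𝓕 S x).re‖ₑ ≤ ∫⁻ ξ, ‖𝓕 (fun x => (F x : ℂ)) ξ‖ₑ * B ξ := by
  have hFc : Integrable (fun x => (F x : ℂ)) := hF.ofReal
  have hi : Integrable (fun x => (F x : ℂ) * 𝓕 S x) := integrable_mul_fourier hFc hS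
  have h1 : ∫ x, F x * (𝓕 S x).re = (∫ x, (F x : ℂ) * 𝓕 S x).re := by
    have h2 := Complex.reCLM.integral_comp_comm hi
    simp only [Complex.reCLM_apply, Complex.mul_re, Complex.ofReal_re, Complex.ofReal_im,
      zero_mul, sub_zero] at h2
    exact h2
  rw [h1, integral_mul_fourier_eq hFc hS]
  calc ‖(∫ ξ, 𝓕 (fun x => (F x : ℂ)) ξ * S ξ).re‖ₑ
      ≤ ‖∫ ξ, 𝓕 (fun x => (F x : ℂ)) ξ * S ξ‖ₑ := by
        rw [← ofReal_norm, ← ofReal_norm]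
        exact ENNReal.ofReal_le_ofReal (Complex.abs_re_le_norm _)
    _ ≤ ∫⁻ ξ, ‖𝓕 (fun x => (F x : ℂ)) ξ * S ξ‖ₑ := enorm_integral_le_lintegral_enorm _
    _ ≤ ∫⁻ ξ, ‖𝓕 (fun x => (F x : ℂ)) ξ‖ₑ * B ξ := lintegral_mono fun ξ => by
        rw [enorm_mul]
        exact mul_le_mul' le_rfl (hB ξ)

/-! ### Derivatives, smoothness, `L²` -/

/-- Integrability of `fourierSMulRight (innerSL ℝ) n` from the first moment. [folklore] -/
theorem integrable_fourierSMulRight_of_moment (hn : Integrable n)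
    (hn1 : Integrable fun ξ : ℝ³ => ‖ξ‖ * ‖n ξ‖) :
    Integrable (VectorFourier.fourierSMulRight (innerSL ℝ) n) := by
  refine (hn1.const_mul (2 * π * ‖(innerSL ℝ : ℝ³ →L[ℝ] ℝ³ →L[ℝ] ℝ)‖)).mono'
    hn.1.fourierSMulRight (Eventually.of_forall fun ξ => ?_)
  exact (VectorFourier.norm_fourierSMulRight_le _ n ξ).trans (le_of_eq (by ring))

/-- **`∂ᵥ 𝓕 n = 𝓕 (-2πi⟪ξ, v⟫ n)`**, evaluated (Mathlib `Real.fderiv_fourier`), for an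
integrable symbol with integrable first moment. [folklore] -/
theorem fderiv_fourier_apply_of_moment (hn : Integrable n)
    (hn1 : Integrable fun ξ : ℝ³ => ‖ξ‖ * ‖n ξ‖) (x v : ℝ³) :
    fderiv ℝ (𝓕 n) x v = 𝓕 (fun ξ => (-(2 * π * I) * (⟪ξ, v⟫ : ℂ)) * n ξ) x := by
  rw [Real.fderiv_fourier hn hn1, Real.fourier_continuousLinearMap_apply
    (integrable_fourierSMulRight_of_moment hn hn1)]
  have hfun : (fun ξ : ℝ³ => VectorFourier.fourierSMulRight (innerSL ℝ) n ξ v) =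
      fun ξ : ℝ³ => (-(2 * π * I) * (⟪ξ, v⟫ : ℂ)) * n ξ := by
    funext ξ
    change -(2 * π * I) • ((⟪ξ, v⟫ : ℝ) • n ξ) = _
    rw [Complex.real_smul, smul_eq_mul]
    ring
  rw [hfun]

/-- The derivative symbol `-2πi⟪ξ, v⟫ n(ξ)` has norm at most `2π ‖v‖ ‖ξ‖ ‖n ξ‖`. [folklore] -/
theorem norm_derivSymbol_le (n : ℝ³ → ℂ) (ξ v : ℝ³) :
    ‖(-(2 * π * I) * (⟪ξ, v⟫ : ℂ)) * n ξ‖ ≤ 2 * π * ‖v‖ * (‖ξ‖ * ‖n ξ‖) := by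
  have h2π : ‖(-(2 * π * I) : ℂ)‖ = 2 * π := by
    rw [norm_neg, norm_mul, norm_mul, Complex.norm_I, mul_one, Complex.norm_real,
      Real.norm_of_nonneg pi_pos.le, Complex.norm_ofNat]
  rw [norm_mul, norm_mul, h2π, Complex.norm_real, Real.norm_eq_abs]
  have h := abs_real_inner_le_norm ξ v
  nlinarith [norm_nonneg (n ξ), norm_nonneg v, norm_nonneg ξ, pi_pos,
    mul_nonneg (norm_nonneg (n ξ)) (sub_nonneg.2 h)]

/-- The derivative symbol is integrable. [folklore] -/
theorem integrable_derivSymbol (hn1 : Integrable fun ξ : ℝ³ => ‖ξ‖ * ‖n ξ‖)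
    (hnm : AEStronglyMeasurable n volume) (v : ℝ³) :
    Integrable fun ξ : ℝ³ => (-(2 * π * I) * (⟪ξ, v⟫ : ℂ)) * n ξ := by
  refine (hn1.const_mul (2 * π * ‖v‖)).mono' ?_ (Eventually.of_forall fun ξ => ?_)
  · exact ((continuous_const.mul (Complex.continuous_ofReal.comp
      (continuous_id.inner continuous_const))).aestronglyMeasurable).mul hnm
  · exact norm_derivSymbol_le n ξ v

/-- **Real part, derivative**: `∂ᵥ re(𝓕 n) = re 𝓕(-2πi⟪ξ,v⟫ n)`. [folklore] -/
theorem fderiv_re_fourier_apply (hn : Integrable n)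
    (hn1 : Integrable fun ξ : ℝ³ => ‖ξ‖ * ‖n ξ‖) (x v : ℝ³) :
    fderiv ℝ (fun y => (𝓕 n y).re) x v =
      (𝓕 (fun ξ => (-(2 * π * I) * (⟪ξ, v⟫ : ℂ)) * n ξ) x).re := by
  have hd : DifferentiableAt ℝ (𝓕 n) x := (Real.differentiable_fourier hn hn1) x
  have h := fderiv_comp x Complex.reCLM.differentiableAt hd
  rw [show (fun y => (𝓕 n y).re) = Complex.reCLM ∘ 𝓕 n from rfl, h, Complex.reCLM.fderiv]
  simp only [ContinuousLinearMap.coe_comp, Function.comp_apply, Complex.reCLM_apply]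
  rw [fderiv_fourier_apply_of_moment hn hn1]

/-- **Smoothness**: if all moments `‖ξ‖^k ‖n ξ‖` are integrable, `re 𝓕 n` is `C^∞`. [folklore] -/
theorem contDiff_re_fourier (hmom : ∀ k : ℕ, Integrable fun ξ : ℝ³ => ‖ξ‖ ^ k * ‖n ξ‖) :
    ContDiff ℝ ∞ fun x => (𝓕 n x).re := by
  have h : ContDiff ℝ ∞ (𝓕 n) := Real.contDiff_fourier (N := (⊤ : ℕ∞)) fun k _ => hmom k
  exact Complex.reCLM.contDiff.comp h

/-- **Plancherel for the real part**: for `n ∈ L¹ ∩ L²`, `∫ |re 𝓕 n|² ≤ ∫ |n|²`. [folklore] -/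
theorem lintegral_enorm_re_fourier_sq_le (hn : Integrable n) (hn2 : MemLp n 2 volume) :
    ∫⁻ x, ‖(𝓕 n x).re‖ₑ ^ 2 ≤ ∫⁻ ξ, ‖n ξ‖ₑ ^ 2 := by
  rw [← Literature.Analysis.FunctionSpaces.lintegral_enorm_sq_fourierIntegral_eq hn hn2]
  refine lintegral_mono fun x => ?_
  gcongr
  rw [← ofReal_norm, ← ofReal_norm]
  exact ENNReal.ofReal_le_ofReal (Complex.abs_re_le_norm _)

/-- `re 𝓕 n ∈ L²` for `n ∈ L¹ ∩ L²`. [folklore] -/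
theorem memLp_two_re_fourier (hn : Integrable n) (hn2 : MemLp n 2 volume) :
    MemLp (fun x => (𝓕 n x).re) 2 volume := by
  refine ⟨(Complex.continuous_re.comp (continuous_fourier_of_integrable hn)).aestronglyMeasurable,
    ?_⟩
  rw [eLpNorm_lt_top_iff_lintegral_rpow_enorm_lt_top two_ne_zero ENNReal.ofNat_ne_top]
  simp only [ENNReal.toReal_ofNat, ENNReal.rpow_ofNat]
  refine (lintegral_enorm_re_fourier_sq_le hn hn2).trans_lt ?_
  have h := lintegral_rpow_enorm_lt_top_of_eLpNorm_lt_top two_ne_zero ENNReal.ofNat_ne_top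
    hn2.eLpNorm_lt_top
  simpa only [ENNReal.toReal_ofNat, ENNReal.rpow_ofNat] using h

end Symbols

/-! ### The heat flow acts on `re 𝓕 n` through the heat symbol -/

section Heat

variable {n : ℝ³ → ℂ}

/-- The heat symbol is even. [folklore] -/
theorem heatSymbol_neg (s : ℝ) (ξ : ℝ³) : heatSymbol s (-ξ) = heatSymbol s ξ := by
  simp [heatSymbol, norm_neg]

/-- `∫ 𝐞(⟪y, ξ⟫) G_s(y) dy = 𝓕 G_s (-ξ) = e^{-4π²s‖ξ‖²}`. [folklore] -/
theorem integral_fourierChar_mul_heatKernel {s : ℝ} (hs : 0 < s) (ξ : ℝ³) :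
    ∫ y : ℝ³, ((𝐞 ⟪y, ξ⟫ : Circle) : ℂ) * (heatKernel s y : ℂ) = (heatSymbol s ξ : ℂ) := by
  have h := fourierIntegral_heatKernel_holds (E := ℝ³) hs (-ξ)
  rw [Real.fourier_eq] at h
  simp only [inner_neg_right, neg_neg, Circle.smul_def, smul_eq_mul] at h
  rw [h, heatSymbol_neg]

/-- **The caloric extension of `re 𝓕 n` is `re 𝓕 (e^{-4π²s|ξ|²} n)`** for an integrable symbol
`n` and `0 < s` (Fubini: `∫ G_s(y) 𝓕n(x - y) dy = ∫ n(ξ) 𝐞(-⟪ξ,x⟫) 𝓕G_s(-ξ) dξ`). [folklore] -/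
theorem heatExtension_re_fourier (hn : Integrable n) {s : ℝ} (hs : 0 < s) (x : ℝ³) :
    heatExtension (fun y => (𝓕 n y).re) s x =
      (𝓕 (fun ξ => (heatSymbol s ξ : ℂ) * n ξ) x).re := by
  have hK : Integrable (fun y : ℝ³ => (heatKernel s y : ℂ)) := (integrable_heatKernel_holds hs).ofReal
  -- step 1: complexify
  have hI : Integrable (fun y : ℝ³ => (heatKernel s y : ℂ) * 𝓕 n (x - y)) := by
    refine hK.mul_bdd ?_ (Eventually.of_forall fun y => norm_fourier_le_integral_norm n (x - y))
    exact ((continuous_fourier_of_integrable hn).comp (continuous_const.sub continuous_id)).aestronglyMeasurable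
  have h1 : heatExtension (fun y => (𝓕 n y).re) s x =
      (∫ y, (heatKernel s y : ℂ) * 𝓕 n (x - y)).re := by
    rw [heatExtension_apply]
    have h2 := Complex.reCLM.integral_comp_comm hI
    simp only [Complex.reCLM_apply, Complex.mul_re, Complex.ofReal_re, Complex.ofReal_im,
      zero_mul, sub_zero] at h2
    simp only [smul_eq_mul]
    exact h2
  rw [h1]
  congr 1
  -- step 2: the double integral and Fubini
  set G : ℝ³ → ℝ³ → ℂ := fun y ξ => (heatKernel s y : ℂ) * (((𝐞 (-⟪ξ, x - y⟫) : Circle) : ℂ) * n ξ)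
    with hG
  have hinner : ∀ y, (heatKernel s y : ℂ) * 𝓕 n (x - y) = ∫ ξ, G y ξ := by
    intro y
    rw [Real.fourier_eq, ← integral_const_mul]
    refine integral_congr_ae (Eventually.of_forall fun ξ => ?_)
    simp only [hG, Circle.smul_def, smul_eq_mul]
  have hGm : AEStronglyMeasurable (uncurry G) (volume.prod volume) := by
    have hc : Continuous fun p : ℝ³ × ℝ³ =>
        (heatKernel s p.1 : ℂ) * (((𝐞 (-⟪p.2, x - p.1⟫) : Circle) : ℂ)) := by
      refine (Complex.continuous_ofReal.comp ((continuous_heatKernel s).comp continuous_fst)).mul ?_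
      exact continuous_subtype_val.comp (Real.continuous_fourierChar.comp
        ((continuous_snd.inner (continuous_const.sub continuous_fst)).neg))
    refine (hc.aestronglyMeasurable.mul hn.1.comp_snd).congr (Eventually.of_forall fun p => ?_)
    simp only [hG, uncurry, Pi.mul_apply, mul_assoc]
  have hGi : Integrable (uncurry G) (volume.prod volume) := by
    refine (hK.mul_prod hn).mono hGm (Eventually.of_forall fun p => ?_)
    simp only [hG, uncurry, norm_mul, Circle.norm_coe, one_mul, le_rfl]
  have hswap : ∫ y, ∫ ξ, G y ξ = ∫ ξ, ∫ y, G y ξ := integral_integral_swap hGi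
  rw [integral_congr_ae (Eventually.of_forall hinner), hswap, Real.fourier_eq]
  refine integral_congr_ae (Eventually.of_forall fun ξ => ?_)
  -- step 3: the inner `y`-integral is `𝐞(-⟪ξ,x⟫) 𝓕G_s(-ξ) n(ξ)`
  have hchar : ∀ y, (((𝐞 (-⟪ξ, x - y⟫) : Circle) : ℂ)) =
      ((𝐞 (-⟪ξ, x⟫) : Circle) : ℂ) * ((𝐞 ⟪y, ξ⟫ : Circle) : ℂ) := by
    intro y
    rw [inner_sub_right, neg_sub', sub_eq_add_neg, neg_neg, real_inner_comm ξ y,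
      AddChar.map_add_eq_mul, Circle.coe_mul]
  have hfac : ∀ y, G y ξ = (((𝐞 (-⟪ξ, x⟫) : Circle) : ℂ) * n ξ) *
      (((𝐞 ⟪y, ξ⟫ : Circle) : ℂ) * (heatKernel s y : ℂ)) := by
    intro y; simp only [hG, hchar y]; ring
  simp only [hfac, integral_const_mul, integral_fourierChar_mul_heatKernel hs, Circle.smul_def,
    smul_eq_mul]
  ring

end Heat

/-! ## The symbols: Leray projection of the translated heat kernel -/

section LeraySymbol

/-- **Gaussian moments are integrable on `ℝ³`**: `‖ξ‖ᵏ e^{-b‖ξ‖²} ∈ L¹` for `b > 0`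
(domination `rᵏ ≤ 1 + r^{2k}`, `r^{2k} ≤ k! (2/b)ᵏ e^{(b/2) r²}`). [folklore] -/
theorem integrable_pow_mul_gaussian {b : ℝ} (hb : 0 < b) (k : ℕ) :
    Integrable (fun ξ : ℝ³ => ‖ξ‖ ^ k * Real.exp (-b * ‖ξ‖ ^ 2)) := by
  have hb2 : 0 < b / 2 := by positivity
  set C : ℝ := (k.factorial : ℝ) * (2 / b) ^ k with hC
  have hC0 : 0 ≤ C := by positivity
  have hdom : ∀ ξ : ℝ³, ‖ξ‖ ^ k * Real.exp (-b * ‖ξ‖ ^ 2) ≤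
      Real.exp (-b * ‖ξ‖ ^ 2) + C * Real.exp (-(b / 2) * ‖ξ‖ ^ 2) := by
    intro ξ
    have hr : 0 ≤ ‖ξ‖ := norm_nonneg _
    have h1 : ‖ξ‖ ^ k ≤ 1 + ‖ξ‖ ^ (2 * k) := by
      rcases le_or_gt ‖ξ‖ 1 with hr1 | hr1
      · have := pow_le_one₀ (n := k) hr hr1
        nlinarith [pow_nonneg hr (2 * k)]
      · have := pow_le_pow_right₀ hr1.le (show k ≤ 2 * k by omega)
        linarith
    have h2 : ‖ξ‖ ^ (2 * k) ≤ C * Real.exp (b / 2 * ‖ξ‖ ^ 2) := by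
      have hx : 0 ≤ b / 2 * ‖ξ‖ ^ 2 := by positivity
      have h := Real.pow_div_factorial_le_exp (b / 2 * ‖ξ‖ ^ 2) hx k
      rw [div_le_iff₀ (by positivity : (0 : ℝ) < k.factorial)] at h
      have hkey : ‖ξ‖ ^ (2 * k) = (2 / b) ^ k * (b / 2 * ‖ξ‖ ^ 2) ^ k := by
        rw [mul_pow, ← mul_assoc, ← mul_pow, show 2 / b * (b / 2) = 1 by field_simp, one_pow,
          one_mul, pow_mul]
      rw [hkey, hC]
      nlinarith [pow_nonneg (show (0 : ℝ) ≤ 2 / b by positivity) k, Real.exp_pos (b / 2 * ‖ξ‖ ^ 2)]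
    have hexp : 0 ≤ Real.exp (-b * ‖ξ‖ ^ 2) := (Real.exp_pos _).le
    calc ‖ξ‖ ^ k * Real.exp (-b * ‖ξ‖ ^ 2)
        ≤ (1 + ‖ξ‖ ^ (2 * k)) * Real.exp (-b * ‖ξ‖ ^ 2) := by gcongr
      _ ≤ (1 + C * Real.exp (b / 2 * ‖ξ‖ ^ 2)) * Real.exp (-b * ‖ξ‖ ^ 2) := by gcongr
      _ = Real.exp (-b * ‖ξ‖ ^ 2) + C * Real.exp (-(b / 2) * ‖ξ‖ ^ 2) := by
          have : Real.exp (b / 2 * ‖ξ‖ ^ 2) * Real.exp (-b * ‖ξ‖ ^ 2) =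
              Real.exp (-(b / 2) * ‖ξ‖ ^ 2) := by
            rw [← Real.exp_add]; congr 1; ring
          rw [add_mul, one_mul, mul_assoc, this]
  refine Integrable.mono' ((integrable_gaussian_of_pos hb).add
    ((integrable_gaussian_of_pos hb2).const_mul C)) (by fun_prop : Continuous fun ξ : ℝ³ =>
      ‖ξ‖ ^ k * Real.exp (-b * ‖ξ‖ ^ 2)).aestronglyMeasurable (Eventually.of_forall fun ξ => ?_)
  rw [Real.norm_of_nonneg (by positivity)]
  exact hdom ξ

/-- The heat symbol as a Gaussian `e^{-b‖ξ‖²}`, `b = (2π)²σ`. [folklore] -/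
theorem heatSymbol_eq_gaussian (σ : ℝ) (ξ : ℝ³) :
    heatSymbol σ ξ = Real.exp (-((2 * π) ^ 2 * σ) * ‖ξ‖ ^ 2) := by
  rw [heatSymbol]; congr 1; ring

/-- Moments of the heat symbol are integrable (`0 < σ`). [folklore] -/
theorem integrable_pow_mul_heatSymbol {σ : ℝ} (hσ : 0 < σ) (k : ℕ) :
    Integrable (fun ξ : ℝ³ => ‖ξ‖ ^ k * heatSymbol σ ξ) := by
  simp only [heatSymbol_eq_gaussian]
  exact integrable_pow_mul_gaussian (by positivity) k

/-- The heat symbol is integrable (`0 < σ`). [folklore] -/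
theorem integrable_heatSymbol {σ : ℝ} (hσ : 0 < σ) : Integrable (fun ξ : ℝ³ => heatSymbol σ ξ) := by
  simpa using integrable_pow_mul_heatSymbol hσ 0

/-- The `j`-th component of the **Leray symbol applied to `e`**:
`(P̂(ξ) e)ⱼ = eⱼ - ξⱼ ⟪ξ, e⟫ / ‖ξ‖²` (`P̂(ξ) = id - ξ ⊗ ξ/|ξ|²`, the Fourier multiplier of the
Leray projector; junk value `eⱼ` at `ξ = 0`, a null set). [folklore] -/
def projCoeff (e : ℝ³) (j : Fin 3) (ξ : ℝ³) : ℝ := e j - ξ j * ⟪ξ, e⟫ / ‖ξ‖ ^ 2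

/-- `projCoeff e j ξ` is the `j`-th coordinate of the projected vector `e - (⟪ξ,e⟫/‖ξ‖²) ξ`.
[folklore] -/
theorem projCoeff_eq_apply (e : ℝ³) (j : Fin 3) (ξ : ℝ³) :
    projCoeff e j ξ = (e - (⟪ξ, e⟫ / ‖ξ‖ ^ 2) • ξ) j := by
  simp only [projCoeff, PiLp.sub_apply, PiLp.smul_apply, smul_eq_mul]
  ring

/-- `projCoeff e j ξ` is the `j`-th coordinate of the tree's Leray symbol applied to `e`
(`leraySymbol ξ e`, `LerayProjector.lean`). [folklore] -/
theorem projCoeff_eq_leraySymbol_apply (e : ℝ³) (j : Fin 3) (ξ : ℝ³) :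
    projCoeff e j ξ = (leraySymbol ξ e) j := by
  rw [leraySymbol_apply, projCoeff_eq_apply, smul_smul, div_eq_inv_mul]

/-- The projected vector is not longer than `e`: `‖e - (⟪ξ,e⟫/‖ξ‖²) ξ‖ ≤ ‖e‖`
(`‖·‖² = ‖e‖² - ⟪ξ,e⟫²/‖ξ‖²`). [folklore] -/
theorem norm_sub_projSMul_le (e ξ : ℝ³) : ‖e - (⟪ξ, e⟫ / ‖ξ‖ ^ 2) • ξ‖ ≤ ‖e‖ := by
  by_cases hξ : ξ = 0
  · simp [hξ]
  have hn : 0 < ‖ξ‖ ^ 2 := by positivity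
  rw [← sq_le_sq₀ (norm_nonneg _) (norm_nonneg _), norm_sub_sq_real, inner_smul_right,
    norm_smul, mul_pow, Real.norm_eq_abs, sq_abs, real_inner_comm ξ e]
  have h : 2 * (⟪ξ, e⟫ / ‖ξ‖ ^ 2 * ⟪ξ, e⟫) - (⟪ξ, e⟫ / ‖ξ‖ ^ 2) ^ 2 * ‖ξ‖ ^ 2 =
      ⟪ξ, e⟫ ^ 2 / ‖ξ‖ ^ 2 := by
    field_simp
    ring
  have h0 : 0 ≤ ⟪ξ, e⟫ ^ 2 / ‖ξ‖ ^ 2 := by positivity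
  linarith

/-- `|(P̂(ξ)e)ⱼ| ≤ ‖e‖`. [folklore] -/
theorem abs_projCoeff_le (e : ℝ³) (j : Fin 3) (ξ : ℝ³) : |projCoeff e j ξ| ≤ ‖e‖ := by
  rw [projCoeff_eq_apply, ← Real.norm_eq_abs]
  exact (PiLp.norm_apply_le _ j).trans (norm_sub_projSMul_le e ξ)

/-- Coordinates and the inner product on `ℝ³`: `⟪ξ, e⟫ = Σⱼ ξⱼ eⱼ`. [folklore] -/
theorem inner_eq_sum_mul (ξ e : ℝ³) : ⟪ξ, e⟫ = ∑ j, ξ j * e j := by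
  simp [PiLp.inner_apply, mul_comm]

/-- `P̂(ξ) e ⊥ ξ`: `Σⱼ ξⱼ (P̂(ξ)e)ⱼ = 0`. [folklore] -/
theorem sum_mul_projCoeff (e ξ : ℝ³) : ∑ j, ξ j * projCoeff e j ξ = 0 := by
  by_cases hξ : ξ = 0
  · simp [hξ]
  have hn : ‖ξ‖ ^ 2 ≠ 0 := by positivity
  have h2 : ∑ j, ξ j * ξ j = ‖ξ‖ ^ 2 := by
    rw [← real_inner_self_eq_norm_sq, inner_eq_sum_mul]
  calc ∑ j, ξ j * projCoeff e j ξ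
      = ∑ j, (ξ j * e j - ξ j * ξ j * (⟪ξ, e⟫ / ‖ξ‖ ^ 2)) :=
        Finset.sum_congr rfl fun j _ => by rw [projCoeff]; ring
    _ = ⟪ξ, e⟫ - ‖ξ‖ ^ 2 * (⟪ξ, e⟫ / ‖ξ‖ ^ 2) := by
        rw [Finset.sum_sub_distrib, ← Finset.sum_mul, h2, ← inner_eq_sum_mul]
    _ = 0 := by rw [mul_div_cancel₀ _ hn, sub_self]

/-- `projCoeff e j` is measurable (the singular point `ξ = 0` is harmless). [folklore] -/
theorem measurable_projCoeff (e : ℝ³) (j : Fin 3) : Measurable (projCoeff e j) := by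
  unfold projCoeff
  fun_prop

/-- The **translated heat symbol** `𝐞(⟪x₀, ξ⟫) e^{-4π²σ‖ξ‖²}`, whose Fourier integral is the
translated Gauss–Weierstrass kernel `G_σ(· - x₀)` (`fourier_transHeatSymbol`). [folklore] -/
def transHeatSymbol (x₀ : ℝ³) (σ : ℝ) (ξ : ℝ³) : ℂ :=
  ((𝐞 ⟪x₀, ξ⟫ : Circle) : ℂ) * (heatSymbol σ ξ : ℂ)

/-- `‖𝐞(⟪x₀,ξ⟫) e^{-4π²σ‖ξ‖²}‖ = e^{-4π²σ‖ξ‖²}`. [folklore] -/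
theorem norm_transHeatSymbol (x₀ : ℝ³) (σ : ℝ) (ξ : ℝ³) :
    ‖transHeatSymbol x₀ σ ξ‖ = heatSymbol σ ξ := by
  rw [transHeatSymbol, norm_mul, Circle.norm_coe, one_mul, Complex.norm_real,
    Real.norm_of_nonneg (heatSymbol_pos σ ξ).le]

/-- The translated heat symbol is continuous. [folklore] -/
theorem continuous_transHeatSymbol (x₀ : ℝ³) (σ : ℝ) : Continuous (transHeatSymbol x₀ σ) := by
  unfold transHeatSymbol heatSymbol
  refine (continuous_subtype_val.comp (Real.continuous_fourierChar.comp
    (continuous_const.inner continuous_id))).mul (Complex.continuous_ofReal.comp ?_)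
  fun_prop

/-- **Semigroup law on the symbol side**: the symbol at time `σ + s` is `e^{-4π²s‖ξ‖²}` times
the symbol at time `σ`. [folklore] -/
theorem transHeatSymbol_add (x₀ : ℝ³) (σ s : ℝ) (ξ : ℝ³) :
    transHeatSymbol x₀ (σ + s) ξ = (heatSymbol s ξ : ℂ) * transHeatSymbol x₀ σ ξ := by
  simp only [transHeatSymbol, heatSymbol]
  rw [show -(2 * π) ^ 2 * (σ + s) * ‖ξ‖ ^ 2 =
    (-(2 * π) ^ 2 * σ * ‖ξ‖ ^ 2) + (-(2 * π) ^ 2 * s * ‖ξ‖ ^ 2) by ring, Real.exp_add]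
  push_cast
  ring

/-- **`𝓕[𝐞(⟪x₀,·⟫) e^{-4π²σ‖·‖²}] = G_σ(· - x₀)`** (`0 < σ`): the phase translates, and
`𝓕 𝓕 G_σ = G_σ` by Fourier inversion and evenness of the Gaussian. [folklore] -/
theorem fourier_transHeatSymbol (x₀ : ℝ³) {σ : ℝ} (hσ : 0 < σ) (x : ℝ³) :
    𝓕 (transHeatSymbol x₀ σ) x = (heatKernel σ (x - x₀) : ℂ) := by
  -- the phase translates the output variable
  have h1 : 𝓕 (transHeatSymbol x₀ σ) x = 𝓕 (fun ξ : ℝ³ => (heatSymbol σ ξ : ℂ)) (x - x₀) := by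
    rw [Real.fourier_eq, Real.fourier_eq]
    refine integral_congr_ae (Eventually.of_forall fun ξ => ?_)
    simp only [transHeatSymbol, Circle.smul_def, smul_eq_mul, ← mul_assoc, ← Circle.coe_mul,
      ← AddChar.map_add_eq_mul]
    congr 3
    rw [inner_sub_right, real_inner_comm x₀ ξ]
    ring
  -- `𝓕 (𝓕 G) (y) = G (-y) = G y`
  have hG : Continuous fun z : ℝ³ => (heatKernel σ z : ℂ) :=
    Complex.continuous_ofReal.comp (continuous_heatKernel σ)
  have hGi : Integrable fun z : ℝ³ => (heatKernel σ z : ℂ) := (integrable_heatKernel_holds hσ).ofReal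
  have hFG : 𝓕 (fun z : ℝ³ => (heatKernel σ z : ℂ)) = fun ξ : ℝ³ => (heatSymbol σ ξ : ℂ) :=
    funext fun ξ => fourierIntegral_heatKernel_holds hσ ξ
  have hFGi : Integrable (𝓕 fun z : ℝ³ => (heatKernel σ z : ℂ)) := by
    rw [hFG]
    exact (integrable_heatSymbol hσ).ofReal
  have h2 : ∀ y : ℝ³, 𝓕 (fun ξ : ℝ³ => (heatSymbol σ ξ : ℂ)) y = (heatKernel σ y : ℂ) := by
    intro y
    have h := congrFun (hG.fourierInv_fourier_eq hGi hFGi) (-y)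
    rw [fourierInv_eq_fourier_neg, neg_neg, hFG] at h
    rw [h, heatKernel_neg]
  rw [h1, h2]

end LeraySymbol

/-! ## The Leray-projected heat kernel `P(G_σ(· - x₀) e)` -/

section LerayHeatField

/-- The symbol of the `j`-th component of `P(G_σ(· - x₀) e)`:
`𝐞(⟪x₀,ξ⟫) e^{-4π²σ‖ξ‖²} (P̂(ξ)e)ⱼ`. [folklore] -/
def lerayHeatSymbol (x₀ : ℝ³) (σ : ℝ) (e : ℝ³) (j : Fin 3) (ξ : ℝ³) : ℂ :=
  transHeatSymbol x₀ σ ξ * (projCoeff e j ξ : ℂ)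

variable {x₀ e : ℝ³} {σ : ℝ}

/-- `‖symbol‖ ≤ ‖e‖ e^{-4π²σ‖ξ‖²}`. [folklore] -/
theorem norm_lerayHeatSymbol_le (x₀ : ℝ³) (σ : ℝ) (e : ℝ³) (j : Fin 3) (ξ : ℝ³) :
    ‖lerayHeatSymbol x₀ σ e j ξ‖ ≤ ‖e‖ * heatSymbol σ ξ := by
  rw [lerayHeatSymbol, norm_mul, norm_transHeatSymbol, Complex.norm_real, Real.norm_eq_abs,
    mul_comm]
  exact mul_le_mul_of_nonneg_right (abs_projCoeff_le e j ξ) (heatSymbol_pos σ ξ).le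

/-- `‖symbol‖ ≤ ‖e‖` for `0 ≤ σ`. [folklore] -/
theorem norm_lerayHeatSymbol_le' (hσ : 0 ≤ σ) (j : Fin 3) (ξ : ℝ³) :
    ‖lerayHeatSymbol x₀ σ e j ξ‖ ≤ ‖e‖ :=
  (norm_lerayHeatSymbol_le x₀ σ e j ξ).trans (mul_le_of_le_one_right (norm_nonneg _)
    (heatSymbol_le_one hσ ξ))

/-- The symbol is measurable. [folklore] -/
theorem aestronglyMeasurable_lerayHeatSymbol (x₀ : ℝ³) (σ : ℝ) (e : ℝ³) (j : Fin 3) :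
    AEStronglyMeasurable (lerayHeatSymbol x₀ σ e j) volume :=
  ((continuous_transHeatSymbol x₀ σ).aestronglyMeasurable).mul
    (Complex.measurable_ofReal.comp (measurable_projCoeff e j)).aestronglyMeasurable

/-- **Moments of the symbol are integrable** (`0 < σ`). [folklore] -/
theorem integrable_pow_mul_lerayHeatSymbol (hσ : 0 < σ) (j : Fin 3) (k : ℕ) :
    Integrable (fun ξ : ℝ³ => ‖ξ‖ ^ k * ‖lerayHeatSymbol x₀ σ e j ξ‖) := by
  refine ((integrable_pow_mul_heatSymbol hσ k).const_mul ‖e‖).mono' ?_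
    (Eventually.of_forall fun ξ => ?_)
  · exact (continuous_norm.pow k).aestronglyMeasurable.mul
      (aestronglyMeasurable_lerayHeatSymbol x₀ σ e j).norm
  · rw [Real.norm_of_nonneg (by positivity)]
    calc ‖ξ‖ ^ k * ‖lerayHeatSymbol x₀ σ e j ξ‖ ≤ ‖ξ‖ ^ k * (‖e‖ * heatSymbol σ ξ) := by
          gcongr; exact norm_lerayHeatSymbol_le x₀ σ e j ξ
      _ = ‖e‖ * (‖ξ‖ ^ k * heatSymbol σ ξ) := by ring

/-- The symbol is integrable (`0 < σ`). [folklore] -/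
theorem integrable_lerayHeatSymbol (hσ : 0 < σ) (j : Fin 3) :
    Integrable (lerayHeatSymbol x₀ σ e j) := by
  have h := integrable_pow_mul_lerayHeatSymbol (x₀ := x₀) (e := e) hσ j 0
  simp only [pow_zero, one_mul] at h
  exact (integrable_norm_iff (aestronglyMeasurable_lerayHeatSymbol x₀ σ e j)).1 h

/-- The first moment of the symbol is integrable (`0 < σ`). [folklore] -/
theorem integrable_norm_mul_lerayHeatSymbol (hσ : 0 < σ) (j : Fin 3) :
    Integrable (fun ξ : ℝ³ => ‖ξ‖ * ‖lerayHeatSymbol x₀ σ e j ξ‖) := by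
  simpa only [pow_one] using integrable_pow_mul_lerayHeatSymbol (x₀ := x₀) (e := e) hσ j 1

/-- The symbol is square integrable (`0 < σ`; it is bounded and integrable). [folklore] -/
theorem memLp_two_lerayHeatSymbol (hσ : 0 < σ) (j : Fin 3) :
    MemLp (lerayHeatSymbol x₀ σ e j) 2 volume := by
  have hm := aestronglyMeasurable_lerayHeatSymbol x₀ σ e j
  rw [memLp_two_iff_integrable_sq_norm hm]
  refine ((integrable_lerayHeatSymbol (x₀ := x₀) (e := e) hσ j).norm.const_mul ‖e‖).mono'
    (hm.norm.pow 2) (Eventually.of_forall fun ξ => ?_)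
  rw [Real.norm_of_nonneg (by positivity), sq]
  exact mul_le_mul_of_nonneg_right (norm_lerayHeatSymbol_le' hσ.le j ξ) (norm_nonneg _)

/-! ### The derivative symbols -/

/-- The symbol of `∂ᵥ` of the `j`-th component: `-2πi⟪ξ,v⟫` times the symbol. [folklore] -/
def lerayHeatDerivSymbol (x₀ : ℝ³) (σ : ℝ) (e v : ℝ³) (j : Fin 3) (ξ : ℝ³) : ℂ :=
  (-(2 * π * I) * (⟪ξ, v⟫ : ℂ)) * lerayHeatSymbol x₀ σ e j ξ

/-- `‖derivative symbol‖ ≤ 2π ‖v‖ ‖e‖ ‖ξ‖ e^{-4π²σ‖ξ‖²}`. [folklore] -/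
theorem norm_lerayHeatDerivSymbol_le (x₀ : ℝ³) (σ : ℝ) (e v : ℝ³) (j : Fin 3) (ξ : ℝ³) :
    ‖lerayHeatDerivSymbol x₀ σ e v j ξ‖ ≤ 2 * π * ‖v‖ * ‖e‖ * (‖ξ‖ * heatSymbol σ ξ) := by
  refine (norm_derivSymbol_le (lerayHeatSymbol x₀ σ e j) ξ v).trans ?_
  calc 2 * π * ‖v‖ * (‖ξ‖ * ‖lerayHeatSymbol x₀ σ e j ξ‖)
      ≤ 2 * π * ‖v‖ * (‖ξ‖ * (‖e‖ * heatSymbol σ ξ)) := by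
        gcongr; exact norm_lerayHeatSymbol_le x₀ σ e j ξ
    _ = 2 * π * ‖v‖ * ‖e‖ * (‖ξ‖ * heatSymbol σ ξ) := by ring

/-- The derivative symbol is integrable (`0 < σ`). [folklore] -/
theorem integrable_lerayHeatDerivSymbol (hσ : 0 < σ) (v : ℝ³) (j : Fin 3) :
    Integrable (lerayHeatDerivSymbol x₀ σ e v j) :=
  integrable_derivSymbol (integrable_norm_mul_lerayHeatSymbol hσ j)
    (aestronglyMeasurable_lerayHeatSymbol x₀ σ e j) v

/-- The derivative symbol is square integrable (`0 < σ`). [folklore] -/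
theorem memLp_two_lerayHeatDerivSymbol (hσ : 0 < σ) (v : ℝ³) (j : Fin 3) :
    MemLp (lerayHeatDerivSymbol x₀ σ e v j) 2 volume := by
  have hm : AEStronglyMeasurable (lerayHeatDerivSymbol x₀ σ e v j) volume :=
    (integrable_lerayHeatDerivSymbol hσ v j).1
  rw [memLp_two_iff_integrable_sq_norm hm]
  refine (((integrable_pow_mul_heatSymbol hσ 2).const_mul ((2 * π * ‖v‖ * ‖e‖) ^ 2)).mono'
    (hm.norm.pow 2) (Eventually.of_forall fun ξ => ?_))
  rw [Real.norm_of_nonneg (by positivity)]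
  have h := norm_lerayHeatDerivSymbol_le x₀ σ e v j ξ
  have h0 : 0 ≤ ‖lerayHeatDerivSymbol x₀ σ e v j ξ‖ := norm_nonneg _
  have hS1 : heatSymbol σ ξ ≤ 1 := heatSymbol_le_one hσ.le ξ
  have hS0 : 0 ≤ heatSymbol σ ξ := (heatSymbol_pos σ ξ).le
  calc ‖lerayHeatDerivSymbol x₀ σ e v j ξ‖ ^ 2
      ≤ (2 * π * ‖v‖ * ‖e‖ * (‖ξ‖ * heatSymbol σ ξ)) ^ 2 := pow_le_pow_left₀ h0 h 2
    _ = (2 * π * ‖v‖ * ‖e‖) ^ 2 * (‖ξ‖ ^ 2 * heatSymbol σ ξ) * heatSymbol σ ξ := by ring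
    _ ≤ (2 * π * ‖v‖ * ‖e‖) ^ 2 * (‖ξ‖ ^ 2 * heatSymbol σ ξ) * 1 := by gcongr
    _ = (2 * π * ‖v‖ * ‖e‖) ^ 2 * (‖ξ‖ ^ 2 * heatSymbol σ ξ) := mul_one _

/-! ### The test field -/

/-- **The Leray-projected translated heat kernel** `P(G_σ(· - x₀) e) : ℝ³ → ℝ³`, defined by its
Fourier integral componentwise: `x ↦ (re 𝓕[𝐞(⟪x₀,·⟫) e^{-4π²σ‖·‖²} (P̂(·)e)ⱼ](x))ⱼ`. For `0 < σ`
it is smooth, square integrable with square-integrable gradient, divergence free, its caloric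
extension at time `s` is the same field at time `σ + s`, and it pairs with every `L²` weakly
divergence-free field `w` like the kernel itself: `∫⟪w, P(G_σ(·-x₀)e)⟫ = ⟪e^{σΔ}w(x₀), e⟫`.
[folklore] -/
def lerayHeatTest (x₀ : ℝ³) (σ : ℝ) (e : ℝ³) : ℝ³ → ℝ³ :=
  famVec fun j x => (𝓕 (lerayHeatSymbol x₀ σ e j) x).re

/-- Components of the test field. [folklore] -/
theorem lerayHeatTest_apply (x₀ : ℝ³) (σ : ℝ) (e x : ℝ³) (j : Fin 3) :
    lerayHeatTest x₀ σ e x j = (𝓕 (lerayHeatSymbol x₀ σ e j) x).re := rfl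

/-- The test field is smooth (`0 < σ`). [folklore] -/
theorem contDiff_lerayHeatTest (hσ : 0 < σ) : ContDiff ℝ ∞ (lerayHeatTest x₀ σ e) :=
  contDiff_famVec fun j => contDiff_re_fourier (integrable_pow_mul_lerayHeatSymbol hσ j)

/-- Components of the test field are bounded by `‖symbol‖_{L¹}`. [folklore] -/
theorem abs_lerayHeatTest_apply_le (x₀ : ℝ³) (σ : ℝ) (e x : ℝ³) (j : Fin 3) :
    |lerayHeatTest x₀ σ e x j| ≤ ∫ ξ, ‖lerayHeatSymbol x₀ σ e j ξ‖ :=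
  (Complex.abs_re_le_norm _).trans (norm_fourier_le_integral_norm _ x)

/-- `‖v‖ ≤ Σⱼ |vⱼ|` on `ℝ³` (local copy of the helper in `NSStrongSpeedBound`). [folklore] -/
private theorem norm_le_sum_abs_apply (v : ℝ³) : ‖v‖ ≤ ∑ j, |v j| := by
  have hv : v = ∑ j, v j • EuclideanSpace.single j (1 : ℝ) := by
    conv_lhs => rw [← (EuclideanSpace.basisFun (Fin 3) ℝ).sum_repr v]
    simp [EuclideanSpace.basisFun_apply]
  conv_lhs => rw [hv]
  refine (norm_sum_le _ _).trans (Finset.sum_le_sum fun j _ => ?_)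
  rw [norm_smul, Real.norm_eq_abs]
  simp

/-- The test field is bounded. [folklore] -/
theorem norm_lerayHeatTest_le (x₀ : ℝ³) (σ : ℝ) (e x : ℝ³) :
    ‖lerayHeatTest x₀ σ e x‖ ≤ ∑ j, ∫ ξ, ‖lerayHeatSymbol x₀ σ e j ξ‖ :=
  (norm_le_sum_abs_apply _).trans (Finset.sum_le_sum fun j _ => abs_lerayHeatTest_apply_le x₀ σ e x j)

/-- **Derivatives of the test field**: `(D P(G_σ e)(x) v)ⱼ = re 𝓕[-2πi⟪ξ,v⟫ symbolⱼ](x)`.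
[folklore] -/
theorem fderiv_lerayHeatTest_apply (hσ : 0 < σ) (x v : ℝ³) (j : Fin 3) :
    fderiv ℝ (lerayHeatTest x₀ σ e) x v j = (𝓕 (lerayHeatDerivSymbol x₀ σ e v j) x).re := by
  rw [lerayHeatTest, fderiv_famVec_apply (fun j => (contDiff_re_fourier
    (integrable_pow_mul_lerayHeatSymbol hσ j)).differentiable (by simp))]
  exact fderiv_re_fourier_apply (integrable_lerayHeatSymbol hσ j)
    (integrable_norm_mul_lerayHeatSymbol hσ j) x v


/-! ### Divergence free -/

/-- `⟪ξ, eᵢ⟫ = ξᵢ` for the standard basis vectors `eᵢ = stdVec i`. [folklore] -/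
theorem inner_stdVec_right (ξ : ℝ³) (i : Fin 3) : ⟪ξ, (stdVec i : ℝ³)⟫ = ξ i := by
  rw [stdVec, EuclideanSpace.inner_single_right]
  simp

/-- **The derivative symbols along the coordinate directions sum to zero on the diagonal**:
`Σᵢ (-2πi ξᵢ) symbolᵢ(ξ) = -2πi 𝐞(⟪x₀,ξ⟫) e^{-4π²σ‖ξ‖²} Σᵢ ξᵢ (P̂(ξ)e)ᵢ = 0` — the Fourier side
of `div P(G_σ e) = 0`. [folklore] -/
theorem sum_lerayHeatDerivSymbol_stdVec (x₀ : ℝ³) (σ : ℝ) (e ξ : ℝ³) :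
    ∑ i, lerayHeatDerivSymbol x₀ σ e (stdVec i) i ξ = 0 := by
  have h : ∀ i, lerayHeatDerivSymbol x₀ σ e (stdVec i) i ξ =
      (-(2 * π * I) * transHeatSymbol x₀ σ ξ) * ((ξ i * projCoeff e i ξ : ℝ) : ℂ) := by
    intro i
    rw [lerayHeatDerivSymbol, lerayHeatSymbol, inner_stdVec_right]
    push_cast
    ring
  simp_rw [h]
  rw [← Finset.mul_sum, ← Complex.ofReal_sum, sum_mul_projCoeff]
  simp

/-- **`P(G_σ(· - x₀) e)` is divergence free** (`0 < σ`). [folklore] -/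
theorem isDivFree_lerayHeatTest (hσ : 0 < σ) : VectorCalculus.IsDivFree (lerayHeatTest x₀ σ e) := by
  intro x
  have hd : DifferentiableAt ℝ (lerayHeatTest x₀ σ e) x :=
    (contDiff_lerayHeatTest hσ).differentiable (by simp) x
  rw [divergence_eq_sum_pderiv hd]
  have h1 : ∀ i, pderiv i (fun y => lerayHeatTest x₀ σ e y i) x =
      (𝓕 (lerayHeatDerivSymbol x₀ σ e (stdVec i) i) x).re := fun i =>
    fderiv_re_fourier_apply (integrable_lerayHeatSymbol hσ i)
      (integrable_norm_mul_lerayHeatSymbol hσ i) x (stdVec i)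
  simp_rw [h1]
  rw [← Complex.re_sum]
  have h2 : ∑ i, 𝓕 (lerayHeatDerivSymbol x₀ σ e (stdVec i) i) x =
      𝓕 (fun ξ => ∑ i, lerayHeatDerivSymbol x₀ σ e (stdVec i) i ξ) x := by
    simp only [Real.fourier_eq]
    rw [← integral_finsetSum _ (fun i _ => ?_)]
    · refine integral_congr_ae (Eventually.of_forall fun ξ => ?_)
      dsimp only
      rw [Finset.smul_sum]
    · exact (Real.fourierIntegral_convergent_iff x).2 (integrable_lerayHeatDerivSymbol hσ _ i)
  rw [h2]
  simp only [sum_lerayHeatDerivSymbol_stdVec]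
  simp [Real.fourier_eq]

/-- The test field is weakly divergence free. [folklore] -/
theorem isWeaklyDivFree_lerayHeatTest (hσ : 0 < σ) : IsWeaklyDivFree (lerayHeatTest x₀ σ e) :=
  VectorCalculus.IsDivFree.isWeaklyDivFree_holds (isDivFree_lerayHeatTest hσ)
    ((contDiff_lerayHeatTest hσ).of_le (by simp))

/-! ### `L²` bounds -/

/-- A bundled family of continuous `L²` functions is in `L²`. [folklore] -/
theorem memLp_two_famVec {g : Fin 3 → ℝ³ → ℝ} (hc : ∀ j, Continuous (g j))
    (hg : ∀ j, MemLp (g j) 2 volume) : MemLp (famVec g) 2 volume := by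
  have hsum : MemLp (fun x => ∑ j, |g j x|) 2 volume :=
    memLp_finsetSum _ fun j _ => (hg j).abs
  refine hsum.of_le (continuous_famVec hc).aestronglyMeasurable (Eventually.of_forall fun x => ?_)
  rw [Real.norm_of_nonneg (Finset.sum_nonneg fun _ _ => abs_nonneg _)]
  exact norm_le_sum_abs_apply _

/-- **`P(G_σ(· - x₀) e) ∈ L²`** (`0 < σ`; Plancherel on each component). [folklore] -/
theorem memLp_two_lerayHeatTest (hσ : 0 < σ) : MemLp (lerayHeatTest x₀ σ e) 2 volume :=
  memLp_two_famVec
    (fun j => Complex.continuous_re.comp (continuous_fourier_of_integrable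
      (integrable_lerayHeatSymbol hσ j)))
    (fun j => memLp_two_re_fourier (integrable_lerayHeatSymbol hσ j) (memLp_two_lerayHeatSymbol hσ j))

/-- The classical gradient of the test field is a weak gradient. [folklore] -/
theorem hasWeakGradient_lerayHeatTest (hσ : 0 < σ) :
    HasWeakGradient (lerayHeatTest x₀ σ e) (fderiv ℝ (lerayHeatTest x₀ σ e)) :=
  hasWeakGradient_fderiv_of_contDiff ((contDiff_lerayHeatTest hσ).of_le (by simp))

/-- The Frobenius norm of the gradient in coordinates:
`|D P(G_σ e)(x)|²_F = Σᵢⱼ (re 𝓕[Sᵢⱼ](x))²`, `Sᵢⱼ` the derivative symbols. [folklore] -/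
theorem frobeniusNormSq_fderiv_lerayHeatTest (hσ : 0 < σ) (x : ℝ³) :
    frobeniusNormSq (fderiv ℝ (lerayHeatTest x₀ σ e) x) =
      ∑ i, ∑ j, (𝓕 (lerayHeatDerivSymbol x₀ σ e (stdVec i) j) x).re ^ 2 := by
  rw [frobeniusNormSq_eq_sum (EuclideanSpace.basisFun (Fin 3) ℝ)]
  refine Finset.sum_congr rfl fun i _ => ?_
  rw [EuclideanSpace.real_norm_sq_eq]
  refine Finset.sum_congr rfl fun j _ => ?_
  rw [show (EuclideanSpace.basisFun (Fin 3) ℝ) i = stdVec i by simp [stdVec],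
    fderiv_lerayHeatTest_apply hσ]

/-- **The gradient of `P(G_σ(· - x₀) e)` is square integrable** (Frobenius; `0 < σ`). [folklore] -/
theorem lintegral_frobeniusNormSq_fderiv_lerayHeatTest_lt_top (hσ : 0 < σ) :
    ∫⁻ x, ENNReal.ofReal (frobeniusNormSq (fderiv ℝ (lerayHeatTest x₀ σ e) x)) < ⊤ := by
  simp_rw [frobeniusNormSq_fderiv_lerayHeatTest hσ]
  have hmeas : ∀ i j, Measurable fun x : ℝ³ =>
      ENNReal.ofReal ((𝓕 (lerayHeatDerivSymbol x₀ σ e (stdVec i) j) x).re ^ 2) := fun i j =>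
    ENNReal.measurable_ofReal.comp ((Complex.continuous_re.comp (continuous_fourier_of_integrable
      (integrable_lerayHeatDerivSymbol hσ _ j))).pow 2).measurable
  have hsplit : ∀ x : ℝ³, ENNReal.ofReal (∑ i, ∑ j,
      (𝓕 (lerayHeatDerivSymbol x₀ σ e (stdVec i) j) x).re ^ 2) =
      ∑ i, ∑ j, ENNReal.ofReal ((𝓕 (lerayHeatDerivSymbol x₀ σ e (stdVec i) j) x).re ^ 2) := by
    intro x
    rw [ENNReal.ofReal_sum_of_nonneg (fun i _ => Finset.sum_nonneg fun j _ => sq_nonneg _)]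
    refine Finset.sum_congr rfl fun i _ => ?_
    exact ENNReal.ofReal_sum_of_nonneg fun j _ => sq_nonneg _
  simp_rw [hsplit]
  rw [lintegral_finsetSum _ fun i _ => Finset.measurable_sum _ fun j _ => hmeas i j]
  refine ENNReal.sum_lt_top.2 fun i _ => ?_
  rw [lintegral_finsetSum _ fun j _ => hmeas i j]
  refine ENNReal.sum_lt_top.2 fun j _ => ?_
  have hpt : ∀ x : ℝ³, ENNReal.ofReal ((𝓕 (lerayHeatDerivSymbol x₀ σ e (stdVec i) j) x).re ^ 2) =
      ‖(𝓕 (lerayHeatDerivSymbol x₀ σ e (stdVec i) j) x).re‖ₑ ^ 2 := fun x => by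
    rw [← sq_abs, ENNReal.ofReal_pow (abs_nonneg _), ← Real.norm_eq_abs, ofReal_norm]
  simp_rw [hpt]
  refine (lintegral_enorm_re_fourier_sq_le (integrable_lerayHeatDerivSymbol hσ _ j)
    (memLp_two_lerayHeatDerivSymbol hσ _ j)).trans_lt ?_
  have h := lintegral_rpow_enorm_lt_top_of_eLpNorm_lt_top two_ne_zero ENNReal.ofNat_ne_top
    (memLp_two_lerayHeatDerivSymbol (x₀ := x₀) (e := e) hσ (stdVec i) j).eLpNorm_lt_top
  simpa only [ENNReal.toReal_ofNat, ENNReal.rpow_ofNat] using h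

/-! ### The heat flow acts by shifting the time parameter -/

/-- **`e^{sΔ} P(G_σ(· - x₀) e) = P(G_{σ+s}(· - x₀) e)`** (`0 < σ`, `0 < s`): componentwise the
heat flow multiplies the symbol by `e^{-4π²s‖ξ‖²}` (`heatExtension_re_fourier`), which is the
semigroup law on the symbol side. [folklore] -/
theorem heatExtension_lerayHeatTest (hσ : 0 < σ) {s : ℝ} (hs : 0 < s) (x : ℝ³) :
    heatExtension (lerayHeatTest x₀ σ e) s x = lerayHeatTest x₀ (σ + s) e x := by
  -- integrability of the convolution integrand (bounded field, `L¹` kernel)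
  set C : ℝ := ∑ j, ∫ ξ, ‖lerayHeatSymbol x₀ σ e j ξ‖ with hC
  have hbdd : MemLp (fun y => lerayHeatTest x₀ σ e (x - y)) ⊤ volume :=
    memLp_top_of_bound (((contDiff_lerayHeatTest hσ).continuous.comp
      (continuous_const.sub continuous_id)).aestronglyMeasurable) C
      (Eventually.of_forall fun y => norm_lerayHeatTest_le x₀ σ e (x - y))
  have hint : Integrable (fun y => heatKernel s y • lerayHeatTest x₀ σ e (x - y)) :=
    (integrable_heatKernel_holds hs).smul_of_top_left hbdd
  ext j
  rw [lerayHeatTest_apply, heatExtension_apply]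
  have hproj : (∫ y, heatKernel s y • lerayHeatTest x₀ σ e (x - y)) j =
      ∫ y, heatKernel s y * (𝓕 (lerayHeatSymbol x₀ σ e j) (x - y)).re := by
    have h := (EuclideanSpace.proj j : ℝ³ →L[ℝ] ℝ).integral_comp_comm hint
    rw [show (∫ y, heatKernel s y • lerayHeatTest x₀ σ e (x - y)) j =
      (EuclideanSpace.proj j : ℝ³ →L[ℝ] ℝ) (∫ y, heatKernel s y • lerayHeatTest x₀ σ e (x - y))
      from rfl, ← h]
    exact integral_congr_ae (Eventually.of_forall fun y => rfl)
  rw [hproj]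
  have h2 := heatExtension_re_fourier (integrable_lerayHeatSymbol (x₀ := x₀) (e := e) hσ j) hs x
  rw [heatExtension_apply] at h2
  simp only [smul_eq_mul] at h2
  rw [h2, show (fun ξ => (heatSymbol s ξ : ℂ) * lerayHeatSymbol x₀ σ e j ξ) =
    lerayHeatSymbol x₀ (σ + s) e j from funext fun ξ => by
      rw [lerayHeatSymbol, lerayHeatSymbol, transHeatSymbol_add]; ring]

/-! ### The pairing bound for the derivative entries -/

/-- **The pairing bound.** For an integrable real `F` and `0 < σ`,
`‖∫ F(x) (D P(G_σ e)(x) v)ⱼ dx‖ ≤ 2π‖v‖‖e‖ ∫ ‖ξ‖ e^{-4π²σ‖ξ‖²} |𝓕F(ξ)| dξ`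
(multiplication formula and the bound on the derivative symbol). [folklore] -/
theorem enorm_integral_mul_fderiv_lerayHeatTest_le (hσ : 0 < σ) {F : ℝ³ → ℝ} (hF : Integrable F)
    (v : ℝ³) (j : Fin 3) :
    ‖∫ x, F x * fderiv ℝ (lerayHeatTest x₀ σ e) x v j‖ₑ ≤
      ENNReal.ofReal (2 * π * ‖v‖ * ‖e‖) *
        ∫⁻ ξ, ‖ξ‖ₑ * ENNReal.ofReal (heatSymbol σ ξ) * ‖𝓕 (fun x => (F x : ℂ)) ξ‖ₑ := by
  simp_rw [fderiv_lerayHeatTest_apply hσ]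
  refine (enorm_integral_mul_re_fourier_le hF (integrable_lerayHeatDerivSymbol hσ v j)
    (B := fun ξ => ENNReal.ofReal (2 * π * ‖v‖ * ‖e‖) * (‖ξ‖ₑ * ENNReal.ofReal (heatSymbol σ ξ)))
    (fun ξ => ?_)).trans (le_of_eq ?_)
  · rw [← ofReal_norm, ← ofReal_norm, ← ENNReal.ofReal_mul (norm_nonneg _),
      ← ENNReal.ofReal_mul (by positivity)]
    exact ENNReal.ofReal_le_ofReal (norm_lerayHeatDerivSymbol_le x₀ σ e v j ξ)
  · rw [← lintegral_const_mul' _ _ ENNReal.ofReal_ne_top]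
    refine lintegral_congr fun ξ => ?_
    ring

end LerayHeatField

/-! ## `L²` weakly divergence-free fields are orthogonal to `L²` gradients of smooth potentials -/

section Orthogonality

/-- **The gradient in coordinates**: `∇Q(x) = (∂ⱼQ(x))ⱼ` on `ℝ³` (Mathlib's `gradient` is the
Riesz representative of `DQ(x)`). [folklore] -/
theorem gradient_eq_famVec (Q : ℝ³ → ℝ) (x : ℝ³) :
    gradient Q x = famVec (fun j y => fderiv ℝ Q y (stdVec j)) x := by
  ext j
  rw [famVec_apply, ← inner_gradient_eq_fderiv_apply, real_inner_comm, stdVec,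
    EuclideanSpace.inner_single_right]
  simp

/-- A divergence-free test field is orthogonal to the gradient of **any** smooth potential (no
decay needed: replace `Q` by `χQ` with a cut-off `χ = 1` near the support of the field). [folklore] -/
theorem integral_inner_gradient_eq_zero_of_test {Φ : ℝ³ → ℝ³}
    (hΦ : FunctionSpaces.IsTestFunctionOn (⊤ : TopologicalSpace.Opens ℝ³) Φ)
    (hΦdiv : VectorCalculus.IsDivFree Φ) {Q : ℝ³ → ℝ} (hQ : ContDiff ℝ ∞ Q) :
    ∫ x, ⟪Φ x, gradient Q x⟫ = 0 := by
  obtain ⟨R₀, hR₀⟩ := hΦ.hasCompactSupport.isCompact.isBounded.subset_closedBall 0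
  set R : ℝ := max R₀ 0 + 1 with hR
  have hRpos : 0 < R := by rw [hR]; positivity
  have hsupp : tsupport Φ ⊆ Metric.ball 0 R := hR₀.trans (Metric.closedBall_subset_ball (by
    rw [hR]; linarith [le_max_left R₀ 0]))
  set θ : ℝ³ → ℝ := fun x => cutoff R x * Q x with hθ
  have hθtest : FunctionSpaces.IsTestFunctionOn (⊤ : TopologicalSpace.Opens ℝ³) θ :=
    { contDiff := (contDiff_cutoff R).mul hQ
      hasCompactSupport := (hasCompactSupport_cutoff hRpos).mul_right
      tsupport_subset := by simp }
  have hweak := VectorCalculus.IsDivFree.isWeaklyDivFree_holds hΦdiv (hΦ.contDiff.of_le (by simp))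
    θ hθtest
  rw [← hweak]
  refine integral_congr_ae (Eventually.of_forall fun x => ?_)
  dsimp only
  by_cases hx : x ∈ tsupport Φ
  · -- `θ = Q` near `x`
    have hball : Metric.ball (0 : ℝ³) R ∈ 𝓝 x := Metric.isOpen_ball.mem_nhds (hsupp hx)
    have heq : θ =ᶠ[𝓝 x] Q := by
      filter_upwards [hball] with y hy
      simp only [hθ, cutoff_eq_one hRpos (le_of_lt (mem_ball_zero_iff.1 hy)), one_mul]
    rw [inner_gradient_eq_fderiv_apply, inner_gradient_eq_fderiv_apply, heq.fderiv_eq]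
  · rw [image_eq_zero_of_notMem_tsupport hx, inner_zero_left, inner_zero_left]

/-- **Orthogonality of `L²_σ` and `L²` gradients.** Let `w ∈ L²(ℝ³; ℝ³)` be weakly divergence
free and `Q ∈ C^∞(ℝ³)` with `∂ⱼQ ∈ L²` for all `j`. Then `∫ ⟪w, ∇Q⟫ = 0`. Proof: `w ∈ L²_σ`
(tree `mem_solenoidalL2_iff_holds`), `C_{c,σ}^∞` is dense in `L²_σ`
(`denseRange_divFreeTestToSolenoidalL2`), each test field is orthogonal to `∇Q`
(`integral_inner_gradient_eq_zero_of_test`), and `v ↦ ∫⟪v, ∇Q⟫` is continuous on `L²`. [folklore] -/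
theorem IsWeaklyDivFree.integral_inner_gradient_eq_zero_of_memLp {w : ℝ³ → ℝ³} (hw2 : MemLp w 2 volume)
    (hdiv : IsWeaklyDivFree w) {Q : ℝ³ → ℝ} (hQ : ContDiff ℝ ∞ Q)
    (hDQ : ∀ j, MemLp (fun x => fderiv ℝ Q x (stdVec j)) 2 volume) :
    ∫ x, ⟪w x, gradient Q x⟫ = 0 := by
  -- the gradient as an `L²` element
  have hGeq : gradient Q = famVec (fun j y => fderiv ℝ Q y (stdVec j)) :=
    funext (gradient_eq_famVec Q)
  have hG2 : MemLp (gradient Q) 2 volume := by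
    rw [hGeq]
    exact memLp_two_famVec (fun j => (hQ.continuous_fderiv (by simp)).clm_apply continuous_const) hDQ
  set G : Lp ℝ³ 2 (volume : Measure ℝ³) := hG2.toLp (gradient Q) with hGdef
  have hGae : (G : ℝ³ → ℝ³) =ᵐ[volume] gradient Q := hG2.coeFn_toLp
  -- `w` as an element of `L²_σ`
  set W : Lp ℝ³ 2 (volume : Measure ℝ³) := hw2.toLp w with hWdef
  have hWae : (W : ℝ³ → ℝ³) =ᵐ[volume] w := hw2.coeFn_toLp
  have hWmem : W ∈ solenoidalL2 ℝ³ := (mem_solenoidalL2_iff_holds W).2 (hdiv.congr_ae hWae.symm)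
  -- the pairing with `G` as a function of the `L²_σ` element
  have hpair : ∀ v : Lp ℝ³ 2 (volume : Measure ℝ³), ⟪v, G⟫ = ∫ x, ⟪(v : ℝ³ → ℝ³) x, gradient Q x⟫ := by
    intro v
    rw [L2.inner_def]
    refine integral_congr_ae ?_
    filter_upwards [hGae] with x hx
    rw [hx]
  have hzero : ⟪W, G⟫ = 0 := by
    have hclosed : IsClosed {v : solenoidalL2 ℝ³ | ⟪(v : Lp ℝ³ 2 (volume : Measure ℝ³)), G⟫ = 0} :=
      isClosed_eq (continuous_subtype_val.inner continuous_const) continuous_const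
    have h := (denseRange_divFreeTestToSolenoidalL2 (E := ℝ³)).induction_on
      (p := fun v : solenoidalL2 ℝ³ => ⟪(v : Lp ℝ³ 2 (volume : Measure ℝ³)), G⟫ = 0)
      ⟨W, hWmem⟩ hclosed fun φ => ?_
    · exact h
    · rw [coe_divFreeTestToSolenoidalL2, hpair]
      rw [integral_congr_ae (by
        filter_upwards [coeFn_divFreeTestToL2 φ] with x hx
        rw [hx])]
      exact integral_inner_gradient_eq_zero_of_test φ.2.1 φ.2.2 hQ
  rw [hpair] at hzero
  rw [← hzero]
  refine integral_congr_ae ?_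
  filter_upwards [hWae] with x hx
  rw [hx]

end Orthogonality

/-! ## The pairing identity `∫⟪w, P(G_σ(· - x₀) e)⟫ = ⟪e^{σΔ} w (x₀), e⟫` -/

section Pairing

variable {x₀ e : ℝ³} {σ : ℝ}

/-- `ξ ↦ ‖ξ‖⁻¹ e^{-4π²σ‖ξ‖²}` is integrable on `ℝ³` (`‖ξ‖⁻¹` is integrable on the unit ball of
`ℝ³`, and bounded by `1` outside). [folklore] -/
theorem integrable_norm_inv_mul_heatSymbol (hσ : 0 < σ) :
    Integrable (fun ξ : ℝ³ => ‖ξ‖⁻¹ * heatSymbol σ ξ) := by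
  have hmeas : AEStronglyMeasurable (fun ξ : ℝ³ => ‖ξ‖⁻¹ * heatSymbol σ ξ) volume := by
    refine (continuous_norm.measurable.inv.mul ?_).aestronglyMeasurable
    unfold heatSymbol; fun_prop
  have hnn : ∀ ξ : ℝ³, 0 ≤ ‖ξ‖⁻¹ * heatSymbol σ ξ := fun ξ =>
    mul_nonneg (inv_nonneg.2 (norm_nonneg _)) (heatSymbol_pos σ ξ).le
  -- on the unit ball
  have h1 : IntegrableOn (fun ξ : ℝ³ => ‖ξ‖⁻¹ * heatSymbol σ ξ) (ball 0 1) := by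
    have hg : IntegrableOn (fun ξ : ℝ³ => ‖ξ‖⁻¹) (ball 0 1) := by
      refine ⟨continuous_norm.measurable.inv.aestronglyMeasurable, ?_⟩
      rw [HasFiniteIntegral]
      calc ∫⁻ ξ in ball (0 : ℝ³) 1, ‖‖ξ‖⁻¹‖ₑ = ∫⁻ ξ in ball (0 : ℝ³) 1, ENNReal.ofReal ‖ξ‖⁻¹ :=
            lintegral_congr fun ξ => by
              rw [← ofReal_norm, Real.norm_of_nonneg (inv_nonneg.2 (norm_nonneg _))]
        _ < ⊤ := by rw [lintegral_ball_norm_inv one_pos]; exact ENNReal.ofReal_lt_top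
    refine hg.mono' hmeas.restrict (ae_of_all _ fun ξ => ?_)
    rw [Real.norm_of_nonneg (hnn ξ)]
    exact mul_le_of_le_one_right (inv_nonneg.2 (norm_nonneg _)) (heatSymbol_le_one hσ.le ξ)
  -- outside the unit ball
  have h2 : IntegrableOn (fun ξ : ℝ³ => ‖ξ‖⁻¹ * heatSymbol σ ξ) (ball 0 1)ᶜ := by
    refine (integrable_heatSymbol hσ).integrableOn.mono' hmeas.restrict ?_
    refine (ae_restrict_iff' (measurableSet_ball (x := (0 : ℝ³)) (ε := 1)).compl).2
      (ae_of_all _ fun ξ hξ => ?_)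
    rw [Real.norm_of_nonneg (hnn ξ)]
    have hξ1 : 1 ≤ ‖ξ‖ := by simpa using hξ
    exact mul_le_of_le_one_left (heatSymbol_pos σ ξ).le (inv_le_one_of_one_le₀ hξ1)
  have h := h1.union h2
  rwa [union_compl_self, integrableOn_univ] at h

/-- The **potential symbol** `c(ξ) = 𝐞(⟪x₀,ξ⟫) e^{-4π²σ‖ξ‖²} (⟪ξ,e⟫/‖ξ‖²) / (-2πi)`, whose
derivative symbols `-2πi ξⱼ c(ξ)` are the gradient parts of the Leray symbols. [folklore] -/
def lerayHeatPotSymbol (x₀ : ℝ³) (σ : ℝ) (e : ℝ³) (ξ : ℝ³) : ℂ :=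
  transHeatSymbol x₀ σ ξ * ((⟪ξ, e⟫ / ‖ξ‖ ^ 2 : ℝ) : ℂ) / (-(2 * π * I))

/-- `-2πi ≠ 0`. [folklore] -/
theorem neg_two_pi_I_ne_zero : (-(2 * π * I) : ℂ) ≠ 0 := by
  simp [pi_ne_zero, Complex.I_ne_zero]

/-- **Splitting of the Leray symbol** into the kernel part and a gradient part:
`symbolⱼ = 𝐞(⟪x₀,ξ⟫)e^{-4π²σ‖ξ‖²} eⱼ - (-2πi⟪ξ, eⱼ⟫) c(ξ)`. [folklore] -/
theorem lerayHeatSymbol_eq_sub (x₀ : ℝ³) (σ : ℝ) (e : ℝ³) (j : Fin 3) (ξ : ℝ³) :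
    lerayHeatSymbol x₀ σ e j ξ = transHeatSymbol x₀ σ ξ * (e j : ℂ) -
      (-(2 * π * I) * (⟪ξ, (stdVec j : ℝ³)⟫ : ℂ)) * lerayHeatPotSymbol x₀ σ e ξ := by
  rw [lerayHeatSymbol, lerayHeatPotSymbol, inner_stdVec_right, projCoeff]
  push_cast
  field_simp [neg_two_pi_I_ne_zero]

/-- `‖c(ξ)‖ ≤ (‖e‖/(2π)) ‖ξ‖⁻¹ e^{-4π²σ‖ξ‖²}`. [folklore] -/
theorem norm_lerayHeatPotSymbol_le (x₀ : ℝ³) (σ : ℝ) (e ξ : ℝ³) :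
    ‖lerayHeatPotSymbol x₀ σ e ξ‖ ≤ ‖e‖ / (2 * π) * (‖ξ‖⁻¹ * heatSymbol σ ξ) := by
  have h2π : ‖(-(2 * π * I) : ℂ)‖ = 2 * π := by
    rw [norm_neg, norm_mul, norm_mul, Complex.norm_I, mul_one, Complex.norm_real,
      Real.norm_of_nonneg pi_pos.le, Complex.norm_ofNat]
  rw [lerayHeatPotSymbol, norm_div, norm_mul, norm_transHeatSymbol, h2π, Complex.norm_real,
    Real.norm_eq_abs, abs_div, abs_of_nonneg (by positivity : (0 : ℝ) ≤ ‖ξ‖ ^ 2)]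
  by_cases hξ : ξ = 0
  · simp [hξ]
  have hn : 0 < ‖ξ‖ := norm_pos_iff.2 hξ
  have hinner : |⟪ξ, e⟫| / ‖ξ‖ ^ 2 ≤ ‖e‖ * ‖ξ‖⁻¹ := by
    rw [div_le_iff₀ (by positivity), show ‖e‖ * ‖ξ‖⁻¹ * ‖ξ‖ ^ 2 = ‖ξ‖ * ‖e‖ by
      field_simp]
    exact abs_real_inner_le_norm ξ e
  have hS : 0 ≤ heatSymbol σ ξ := (heatSymbol_pos σ ξ).le
  calc heatSymbol σ ξ * (|⟪ξ, e⟫| / ‖ξ‖ ^ 2) / (2 * π)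
      ≤ heatSymbol σ ξ * (‖e‖ * ‖ξ‖⁻¹) / (2 * π) := by gcongr
    _ = ‖e‖ / (2 * π) * (‖ξ‖⁻¹ * heatSymbol σ ξ) := by ring

/-- `‖ξ‖ ‖c(ξ)‖ ≤ (‖e‖/(2π)) e^{-4π²σ‖ξ‖²}`. [folklore] -/
theorem norm_mul_norm_lerayHeatPotSymbol_le (x₀ : ℝ³) (σ : ℝ) (e ξ : ℝ³) :
    ‖ξ‖ * ‖lerayHeatPotSymbol x₀ σ e ξ‖ ≤ ‖e‖ / (2 * π) * heatSymbol σ ξ := by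
  by_cases hξ : ξ = 0
  · subst hξ
    simp only [norm_zero, zero_mul]
    exact mul_nonneg (by positivity) (heatSymbol_pos σ _).le
  have hn : 0 < ‖ξ‖ := norm_pos_iff.2 hξ
  calc ‖ξ‖ * ‖lerayHeatPotSymbol x₀ σ e ξ‖
      ≤ ‖ξ‖ * (‖e‖ / (2 * π) * (‖ξ‖⁻¹ * heatSymbol σ ξ)) := by
        gcongr; exact norm_lerayHeatPotSymbol_le x₀ σ e ξ
    _ = ‖e‖ / (2 * π) * heatSymbol σ ξ := by field_simp

/-- The potential symbol is measurable. [folklore] -/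
theorem aestronglyMeasurable_lerayHeatPotSymbol (x₀ : ℝ³) (σ : ℝ) (e : ℝ³) :
    AEStronglyMeasurable (lerayHeatPotSymbol x₀ σ e) volume := by
  have h : lerayHeatPotSymbol x₀ σ e = fun ξ =>
      (transHeatSymbol x₀ σ ξ * ((⟪ξ, e⟫ / ‖ξ‖ ^ 2 : ℝ) : ℂ)) * (-(2 * π * I))⁻¹ := by
    funext ξ; rw [lerayHeatPotSymbol, div_eq_mul_inv]
  rw [h]
  refine (((continuous_transHeatSymbol x₀ σ).aestronglyMeasurable).mul
    (Complex.measurable_ofReal.comp ?_).aestronglyMeasurable).mul aestronglyMeasurable_const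
  fun_prop

/-- **All moments of the potential symbol are integrable** (`0 < σ`; the zeroth moment is the
singular one, `‖ξ‖⁻¹` near the origin). [folklore] -/
theorem integrable_pow_mul_lerayHeatPotSymbol (hσ : 0 < σ) (k : ℕ) :
    Integrable (fun ξ : ℝ³ => ‖ξ‖ ^ k * ‖lerayHeatPotSymbol x₀ σ e ξ‖) := by
  have hm : AEStronglyMeasurable (fun ξ : ℝ³ => ‖ξ‖ ^ k * ‖lerayHeatPotSymbol x₀ σ e ξ‖) volume :=
    (continuous_norm.pow k).aestronglyMeasurable.mul (aestronglyMeasurable_lerayHeatPotSymbol x₀ σ e).norm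
  rcases k with _ | k
  · refine ((integrable_norm_inv_mul_heatSymbol hσ).const_mul (‖e‖ / (2 * π))).mono' hm
      (Eventually.of_forall fun ξ => ?_)
    rw [Real.norm_of_nonneg (by positivity), pow_zero, one_mul]
    exact norm_lerayHeatPotSymbol_le x₀ σ e ξ
  · refine (((integrable_pow_mul_heatSymbol hσ k).const_mul (‖e‖ / (2 * π)))).mono' hm
      (Eventually.of_forall fun ξ => ?_)
    rw [Real.norm_of_nonneg (by positivity), pow_succ, mul_assoc]
    calc ‖ξ‖ ^ k * (‖ξ‖ * ‖lerayHeatPotSymbol x₀ σ e ξ‖)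
        ≤ ‖ξ‖ ^ k * (‖e‖ / (2 * π) * heatSymbol σ ξ) :=
          mul_le_mul_of_nonneg_left (norm_mul_norm_lerayHeatPotSymbol_le x₀ σ e ξ) (by positivity)
      _ = ‖e‖ / (2 * π) * (‖ξ‖ ^ k * heatSymbol σ ξ) := by ring

/-- The potential symbol is integrable. [folklore] -/
theorem integrable_lerayHeatPotSymbol (hσ : 0 < σ) : Integrable (lerayHeatPotSymbol x₀ σ e) := by
  have h := integrable_pow_mul_lerayHeatPotSymbol (x₀ := x₀) (e := e) hσ 0
  simp only [pow_zero, one_mul] at h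
  exact (integrable_norm_iff (aestronglyMeasurable_lerayHeatPotSymbol x₀ σ e)).1 h

/-- The first moment of the potential symbol is integrable. [folklore] -/
theorem integrable_norm_mul_lerayHeatPotSymbol (hσ : 0 < σ) :
    Integrable (fun ξ : ℝ³ => ‖ξ‖ * ‖lerayHeatPotSymbol x₀ σ e ξ‖) := by
  simpa only [pow_one] using integrable_pow_mul_lerayHeatPotSymbol (x₀ := x₀) (e := e) hσ 1

/-- The **potential** `Q = re 𝓕 c`, with `∇Q` the gradient part of `P(G_σ e)`. [folklore] -/
def lerayHeatPot (x₀ : ℝ³) (σ : ℝ) (e : ℝ³) (x : ℝ³) : ℝ := (𝓕 (lerayHeatPotSymbol x₀ σ e) x).re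

/-- The potential is smooth (`0 < σ`). [folklore] -/
theorem contDiff_lerayHeatPot (hσ : 0 < σ) : ContDiff ℝ ∞ (lerayHeatPot x₀ σ e) :=
  contDiff_re_fourier (integrable_pow_mul_lerayHeatPotSymbol hσ)

/-- **Derivatives of the potential**: `∂ᵥQ = re 𝓕[-2πi⟪ξ,v⟫ c]`. [folklore] -/
theorem fderiv_lerayHeatPot_apply (hσ : 0 < σ) (x v : ℝ³) :
    fderiv ℝ (lerayHeatPot x₀ σ e) x v =
      (𝓕 (fun ξ : ℝ³ => (-(2 * π * I) * (⟪ξ, v⟫ : ℂ)) * lerayHeatPotSymbol x₀ σ e ξ) x).re :=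
  fderiv_re_fourier_apply (integrable_lerayHeatPotSymbol hσ)
    (integrable_norm_mul_lerayHeatPotSymbol hσ) x v

/-- The derivative symbol of the potential, `-2πi⟪ξ,v⟫ c(ξ)`, is bounded by `‖v‖‖e‖ e^{-4π²σ‖ξ‖²}`.
[folklore] -/
theorem norm_potDerivSymbol_le (x₀ : ℝ³) (σ : ℝ) (e v ξ : ℝ³) :
    ‖(-(2 * π * I) * (⟪ξ, v⟫ : ℂ)) * lerayHeatPotSymbol x₀ σ e ξ‖ ≤ ‖v‖ * ‖e‖ * heatSymbol σ ξ := by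
  refine (norm_derivSymbol_le (lerayHeatPotSymbol x₀ σ e) ξ v).trans ?_
  calc 2 * π * ‖v‖ * (‖ξ‖ * ‖lerayHeatPotSymbol x₀ σ e ξ‖)
      ≤ 2 * π * ‖v‖ * (‖e‖ / (2 * π) * heatSymbol σ ξ) :=
        mul_le_mul_of_nonneg_left (norm_mul_norm_lerayHeatPotSymbol_le x₀ σ e ξ) (by positivity)
    _ = ‖v‖ * ‖e‖ * heatSymbol σ ξ := by field_simp

/-- The derivative symbol of the potential is in `L¹ ∩ L²` (`0 < σ`). [folklore] -/
theorem integrable_and_memLp_potDerivSymbol (hσ : 0 < σ) (v : ℝ³) :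
    Integrable (fun ξ : ℝ³ => (-(2 * π * I) * (⟪ξ, v⟫ : ℂ)) * lerayHeatPotSymbol x₀ σ e ξ) ∧
      MemLp (fun ξ : ℝ³ => (-(2 * π * I) * (⟪ξ, v⟫ : ℂ)) * lerayHeatPotSymbol x₀ σ e ξ) 2 volume := by
  have hi : Integrable (fun ξ : ℝ³ => (-(2 * π * I) * (⟪ξ, v⟫ : ℂ)) * lerayHeatPotSymbol x₀ σ e ξ) :=
    integrable_derivSymbol (integrable_norm_mul_lerayHeatPotSymbol hσ)
      (aestronglyMeasurable_lerayHeatPotSymbol x₀ σ e) v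
  refine ⟨hi, ?_⟩
  rw [memLp_two_iff_integrable_sq_norm hi.1]
  refine (((integrable_heatSymbol hσ).const_mul ((‖v‖ * ‖e‖) ^ 2)).mono' (hi.1.norm.pow 2)
    (Eventually.of_forall fun ξ => ?_))
  rw [Real.norm_of_nonneg (by positivity)]
  have h := norm_potDerivSymbol_le x₀ σ e v ξ
  have hS1 : heatSymbol σ ξ ≤ 1 := heatSymbol_le_one hσ.le ξ
  have hS0 : 0 ≤ heatSymbol σ ξ := (heatSymbol_pos σ ξ).le
  calc ‖(-(2 * π * I) * (⟪ξ, v⟫ : ℂ)) * lerayHeatPotSymbol x₀ σ e ξ‖ ^ 2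
      ≤ (‖v‖ * ‖e‖ * heatSymbol σ ξ) ^ 2 := pow_le_pow_left₀ (norm_nonneg _) h 2
    _ = (‖v‖ * ‖e‖) ^ 2 * heatSymbol σ ξ * heatSymbol σ ξ := by ring
    _ ≤ (‖v‖ * ‖e‖) ^ 2 * heatSymbol σ ξ * 1 := by gcongr
    _ = (‖v‖ * ‖e‖) ^ 2 * heatSymbol σ ξ := mul_one _

/-- `∂ᵥQ ∈ L²` (`0 < σ`). [folklore] -/
theorem memLp_two_fderiv_lerayHeatPot (hσ : 0 < σ) (v : ℝ³) :
    MemLp (fun x => fderiv ℝ (lerayHeatPot x₀ σ e) x v) 2 volume := by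
  have h := integrable_and_memLp_potDerivSymbol (x₀ := x₀) (e := e) hσ v
  have heq : (fun x => fderiv ℝ (lerayHeatPot x₀ σ e) x v) = fun x =>
      (𝓕 (fun ξ : ℝ³ => (-(2 * π * I) * (⟪ξ, v⟫ : ℂ)) * lerayHeatPotSymbol x₀ σ e ξ) x).re :=
    funext fun x => fderiv_lerayHeatPot_apply hσ x v
  rw [heq]
  exact memLp_two_re_fourier h.1 h.2

/-- **Decomposition of `P(G_σ(· - x₀) e)` into the kernel and a gradient**:
`P(G_σ(· - x₀) e)(x) = G_σ(x - x₀) e - ∇Q(x)`. [folklore] -/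
theorem lerayHeatTest_eq_sub_gradient (hσ : 0 < σ) (x : ℝ³) :
    lerayHeatTest x₀ σ e x = heatKernel σ (x - x₀) • e - gradient (lerayHeatPot x₀ σ e) x := by
  rw [gradient_eq_famVec]
  ext j
  rw [lerayHeatTest_apply, PiLp.sub_apply, PiLp.smul_apply, smul_eq_mul, famVec_apply,
    fderiv_lerayHeatPot_apply hσ]
  have hT : Integrable (transHeatSymbol x₀ σ) := by
    refine ((integrable_heatSymbol hσ).ofReal).mono' (continuous_transHeatSymbol x₀ σ).aestronglyMeasurable
      (Eventually.of_forall fun ξ => ?_)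
    rw [norm_transHeatSymbol]; simp
  have hS := (integrable_and_memLp_potDerivSymbol (x₀ := x₀) (e := e) hσ (stdVec j)).1
  -- linearity of `𝓕`
  have hsplit : 𝓕 (lerayHeatSymbol x₀ σ e j) x =
      𝓕 (fun ξ => transHeatSymbol x₀ σ ξ * (e j : ℂ)) x -
        𝓕 (fun ξ : ℝ³ => (-(2 * π * I) * (⟪ξ, (stdVec j : ℝ³)⟫ : ℂ)) *
          lerayHeatPotSymbol x₀ σ e ξ) x := by
    simp only [Real.fourier_eq]
    rw [← integral_sub ((Real.fourierIntegral_convergent_iff x).2 (hT.mul_const _))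
      ((Real.fourierIntegral_convergent_iff x).2 hS)]
    refine integral_congr_ae (Eventually.of_forall fun ξ => ?_)
    dsimp only
    rw [← smul_sub, lerayHeatSymbol_eq_sub]
  have hfirst : 𝓕 (fun ξ => transHeatSymbol x₀ σ ξ * (e j : ℂ)) x =
      (heatKernel σ (x - x₀) : ℂ) * (e j : ℂ) := by
    rw [← fourier_transHeatSymbol x₀ hσ x, Real.fourier_eq, Real.fourier_eq, ← integral_mul_const]
    refine integral_congr_ae (Eventually.of_forall fun ξ => ?_)
    dsimp only
    rw [Circle.smul_def, Circle.smul_def, smul_eq_mul, smul_eq_mul, mul_assoc]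
  rw [hsplit, hfirst, Complex.sub_re]
  congr 1
  rw [← Complex.ofReal_mul, Complex.ofReal_re]

/-- **The pairing identity.** For `w ∈ L²(ℝ³; ℝ³)` weakly divergence free and `0 < σ`,
`∫ ⟪w, P(G_σ(· - x₀) e)⟫ = ⟪(e^{σΔ} w)(x₀), e⟫`: the gradient part of the test field is
invisible to `w` (`IsWeaklyDivFree.integral_inner_gradient_eq_zero_of_memLp`), and the kernel part
reproduces the caloric extension of `w` at `x₀`. [folklore] -/
theorem integral_inner_lerayHeatTest (hσ : 0 < σ) {w : ℝ³ → ℝ³} (hw2 : MemLp w 2 volume)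
    (hdiv : IsWeaklyDivFree w) :
    ∫ x, ⟪w x, lerayHeatTest x₀ σ e x⟫ = ⟪heatExtension w σ x₀, e⟫ := by
  set Q := lerayHeatPot x₀ σ e with hQ
  have hQs : ContDiff ℝ ∞ Q := contDiff_lerayHeatPot hσ
  have hDQ : ∀ j, MemLp (fun x => fderiv ℝ Q x (stdVec j)) 2 volume := fun j =>
    memLp_two_fderiv_lerayHeatPot hσ (stdVec j)
  have hG2 : MemLp (gradient Q) 2 volume := by
    rw [funext (gradient_eq_famVec Q)]
    exact memLp_two_famVec (fun j => (hQs.continuous_fderiv (by simp)).clm_apply continuous_const) hDQ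
  -- the kernel field `x ↦ G_σ(x - x₀) • e` and its integrability against `w`
  have hKi : Integrable (fun x => heatKernel σ (x - x₀) • w x) := by
    have h := integrable_temperate_mul_heatKernel_smul hσ hw2 one_le_two
      (Function.HasTemperateGrowth.const 1) x₀
    refine h.congr (Eventually.of_forall fun x => ?_)
    simp only [one_mul]
    rw [← neg_sub x x₀, heatKernel_neg]
  have hK2 : MemLp (fun x : ℝ³ => heatKernel σ (x - x₀) • e) 2 volume := by
    have hk : MemLp (fun x : ℝ³ => heatKernel σ (x - x₀)) 2 volume :=
      (memLp_heatKernel (E := ℝ³) hσ one_le_two).comp_measurePreserving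
        (measurePreserving_sub_right volume x₀)
    refine hk.of_le_mul (c := ‖e‖) ?_ (Eventually.of_forall fun x => ?_)
    · exact ((continuous_heatKernel σ).comp (continuous_id.sub continuous_const)).aestronglyMeasurable.smul
        continuous_const.aestronglyMeasurable
    · rw [norm_smul, mul_comm]
  have i1 : Integrable fun x => ⟪w x, heatKernel σ (x - x₀) • e⟫ :=
    FunctionSpaces.integrable_inner_of_eLpNorm_two_lt_top hw2.1 hK2.1 hw2.2 hK2.2
  have i2 : Integrable fun x => ⟪w x, gradient Q x⟫ :=
    FunctionSpaces.integrable_inner_of_eLpNorm_two_lt_top hw2.1 hG2.1 hw2.2 hG2.2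
  -- split
  have hsplit : ∫ x, ⟪w x, lerayHeatTest x₀ σ e x⟫ =
      (∫ x, ⟪w x, heatKernel σ (x - x₀) • e⟫) - ∫ x, ⟪w x, gradient Q x⟫ := by
    rw [← integral_sub i1 i2]
    refine integral_congr_ae (Eventually.of_forall fun x => ?_)
    dsimp only
    rw [lerayHeatTest_eq_sub_gradient hσ, inner_sub_right]
  rw [hsplit, IsWeaklyDivFree.integral_inner_gradient_eq_zero_of_memLp hw2 hdiv hQs hDQ, sub_zero]
  -- the kernel part
  calc ∫ x, ⟪w x, heatKernel σ (x - x₀) • e⟫ = ∫ x, ⟪e, heatKernel σ (x - x₀) • w x⟫ :=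
        integral_congr_ae (Eventually.of_forall fun x => by
          dsimp only
          rw [inner_smul_right, inner_smul_right, real_inner_comm])
    _ = ⟪e, ∫ x, heatKernel σ (x - x₀) • w x⟫ := integral_inner hKi e
    _ = ⟪heatExtension w σ x₀, e⟫ := by
        rw [real_inner_comm, heatExtension_eq_integral_sub]
        congr 2
        funext x
        rw [← neg_sub x x₀, heatKernel_neg]

end Pairing

end Literature.Analysis.FluidPDE

end
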